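/-
Copyright: cell `langlands-arthur-audit` (papers/Langlands/langlands-arthur-audit), unit `pub-arthur-down-g65`
(downstream tracer, gen 65).  Seventeenth file of the exact-support certificates of the downstream register (module M305 of the cell's MODULE-MAP — CLAIMed in
`lean/MODULE-MAP3.md` 2026-08-26T09:22Z).  `DownstreamSupport16.lean` (module M276, sections 131–148: the supports of tranches 128–146) CLOSED at v8 = 189,099 B =
94.5 % of the gate's 200,000-byte bound; this file continues APPEND-ONLY in the same conventions and the same namespace `…Arthur2013.Downstream.Support`, importing
`…DownstreamSupport16` (through it `…DownstreamSupport14` and every earlier support file: the canonical readings `canon` (section 1), `canon₁₃` (section 13), `canon₄₅`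
(section 47) with `canon_implications`, `canon_implications₄₅`, the tops `νtop` / `μtop` / `κtop`, `bookInputs_top`, `not_B_cm`, the carver's `LeafSupport` certificates)
and the register head `…Downstream41`.  A SUPPORT STATEMENT, as before, is a kernel-checked fact about the canonical (minimal) reading of a tranche: each typed statement
:= exactly the conjunction of the register inputs its edges name; « at the top » = every atom of the three DAGs true; « countermodel of leaf l » = the carver's assignment in
which every edge of the DAG holds, every other leaf holds and l fails.  Nothing of sections 1–148 is redeclared or changed.
v1 = section 149 (tranche 147, `Downstream41.lean` v1: row B128 C. Mœglin, Progr. Math. 323 (2017) — the archimedean special unipotent packets ⇐ the book ∧ B75 ∧ the paper's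
globals ⇐ its admitted theta criterion; row A8-p's orthogonal edge re-issued).
v2 (same unit) = section 150 appended (tranche 148, `Downstream41.lean` v2: row B129 Mœglin – Renard, Contemp. Math. 691 (2017) — the complex Arthur packets ⇐ the book ∧ row B128);
nothing of v1 redeclared or changed, no new import.
v3 (unit `pub-arthur-down-g66`) = section 151 appended (tranche 149, NEW `Downstream42.lean` v1 = module M306: row B130 Mœglin – Renard, Nagoya Math. J. 241 (2021) 44–124 =
arXiv:1802.04611 — the Arthur packets of Sp(2n,ℝ) containing a scalar unitary highest weight module ⇐ the book ∧ rows A8 / B68 / B1 / A3 / B128 / B70 / B110; row C55's edge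
re-issued); adds `import …Downstream42` (the new register head); nothing of v1 / v2 redeclared or changed.
v4 (same unit) = section 152 appended (tranche 150, `Downstream42.lean` v2: row B131 C. Mœglin, Manuscripta Math. 127 (2008) — node + quasi-split Sp / SO(2n+1) instances ⇐
the book; row B130's Corollaire 20.2 re-issued with the [manuscripta] binder); nothing of v1 – v3 redeclared or changed, no new import.
v5 (same unit) = section 153 appended (tranche 151, NEW `Downstream43.lean` v1 = module M307: row A8 Mœglin – Renard, JEMS 22 (2020) read again — Prop. 3.2,
§4.2, Thms 4.7 / 4.8 / 9.3 as printed, Rem. 9.4; row A8's edge re-issued with the [noteMR] binder); adds `import …Downstream43` (the new register head); nothing of v1 – v4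
redeclared or changed.
v6 (same unit) = section 154 appended (tranche 152, `Downstream43.lean` v2: row B131's node decomposed into its three family instances and supplied — unitary ⇐ Mok ∧
KMSW-in-full, non-quasi-split SO(2n+1) ⇐ row A5; Ishimoto's sequel denied in the companion reading `canonNoIshSeq`); nothing of v1 – v5 redeclared or changed, no new import.
v7 (unit `pub-arthur-down-g67`) = section 155 appended (tranche 153, `Downstream43.lean` v3: row B75's node decomposed by family — the remainder of section 48's `canon₄₅`
instantiated as row A8-p's orthogonal case ∧ the general-spin instance g in `canon₄₅S`, read with g granted / denied and in the 24 book countermodels); nothing of v1 – v6 redeclared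
or changed, no new import.
v8 (same unit) = section 156 appended (tranche 154, `Downstream43.lean` v4: the « Hypothèse générale » of B71 / B72 re-issued by family — `canon₄₇F` / `canon₄₈F` over
`canon₄₅S`, read with g granted / denied and in the 24 book countermodels); nothing of v1 – v7 redeclared or changed, no new import.
v9 (same unit) = section 157 appended (tranche 155, NEW `Downstream44.lean` v1 = module M308: rows B10 / B47 (Heiermann) re-issued by family — the route through
`canon₄₅S` with g denied); adds `import …Downstream44` (the new register head); nothing of v1 – v8 redeclared or changed.
v10 (same unit) = section 158 appended (tranche 156, `Downstream44.lean` v2: rows B108 (Tadić) / B103 (Tam) / A11 (Chen – Zou) re-issued by family — family readings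
`canon₁₃₁F` / `canon₅₆F`, the route through `canon₄₅S` with g denied, book and Mok countermodels); nothing of v1 – v9 redeclared or changed, no new import.
v11 (same unit) = section 159 appended (tranche 157, `Downstream44.lean` v3: row B16 (CFMMX) re-issued by family — family reading `canon₁₃₅FW`, the route through
`canon₄₅S` with g denied, book / Chapter-9 / Mok readings); nothing of v1 – v10 redeclared or changed, no new import.
-/
import HarnessLib
import Literature.NumberTheory.Automorphic.Arthur2013.DownstreamSupport16
import Literature.NumberTheory.Automorphic.Arthur2013.Downstream41
import Literature.NumberTheory.Automorphic.Arthur2013.Downstream42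
import Literature.NumberTheory.Automorphic.Arthur2013.Downstream43
import Literature.NumberTheory.Automorphic.Arthur2013.Downstream44

set_option autoImplicit false

namespace Literature.NumberTheory.Automorphic.Arthur2013

namespace Downstream

namespace Support

/-! ## 149. Hundred-and-forty-seventh tranche (v1 of this file, after `Downstream41.lean` v1; unit `pub-arthur-down-g65`): supports of row B128 C. Mœglin, Progr. Math. 323 (2017) 469–502
(`MHThm351` = Théorème 3.5.1, `MHThm361` = Théorème 3.6.1, `MHProp362` = Proposition 3.6.2 ⇐ the node `MHThetaHyp` only; `MHThm421` = Théorème 4.2.1, `MHCor422` = Corollaire 4.2.2,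
`MHThm423` = Théorème 4.2.3 ⇐ the book at every rank ∧ row B75's quasi-split statements (book-fed) ∧ the globals) — a reading parametrised by the node's truth value `p`; Mok's memoir and
KMSW occur nowhere in the tranche's B128 edges (μ, κ enter only through the canonical consumers `canon`, `canon₁₃`, `canon₄₅` of sections 1, 13, 47 that the bundle is read against).  Row
A8-p's orthogonal statements keep their section-13 reading `canon₁₃` (the landed edge `E_MRpadicOrth`, book ∧ `StabInner`, is the stronger of the two edges now on the register; the
re-issue `E_MRpadicOrthM` holds in that reading for every `p`). -/

section Canon147

variable (ν : Nodes) (μ : Mok2015.Nodes) (κ : KMSW2014.Nodes) (p : Prop)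

/-- The parametrised canonical reading of the hundred-and-forty-seventh tranche: the node and the three global statements := `p`; the three archimedean statements := the book at every
rank ∧ `p`. [cite: Moeglin2017ArchUnipotentHowe, Thms 3.5.1, 3.6.1, Prop. 3.6.2, Thm 4.2.1, Cor. 4.2.2, Thm 4.2.3 (canonical model; bookkeeping)] -/
abbrev canon₁₄₇ : Consumers147 where
  MHThetaHyp := p
  MHThm351 := p
  MHThm361 := p
  MHProp362 := p
  MHThm421 := (∀ N, ν.Everything N) ∧ p
  MHCor422 := (∀ N, ν.Everything N) ∧ p
  MHThm423 := (∀ N, ν.Everything N) ∧ p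

/-- All seven hundred-and-forty-seventh-tranche edges hold in the canonical reading — the re-issue `E_MRpadicOrthM` read against sections 1 / 13's `canon`, `canon₁₃` —, for arbitrary
ν, μ, κ, p. [cite: Moeglin2017ArchUnipotentHowe, Thms 3.5.1–4.2.3; MoeglinRenard2018, §4.2 (bookkeeping proved here)] -/
theorem canon_implications₁₄₇ : Implications147 ν (canon ν μ κ) (canon₁₃ ν κ) (canon₄₅ ν) (canon₁₄₇ ν p) where
  thm351 := fun h => h
  thm361 := fun h => h
  prop362 := fun h => h
  thm421 := fun b _ h _ => ⟨b, h⟩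
  cor422 := fun b _ h _ => ⟨b, h⟩
  thm423 := fun _ h _ => h
  mrOrthM := fun b s _ _ _ _ _ => ⟨b, s⟩

end Canon147

/-- At the top (every input of the book's DAG; the node granted) all six statements of row B128 hold, and A8-p's orthogonal statements with them — through the tranche's own
`hundredfortyseventh_of_inputs` fed by `bookInputs_top`, section 47's `canon_implications₄₅` and section 1's `canon_implications`. [cite: Moeglin2017ArchUnipotentHowe, Thms 3.5.1–4.2.3 (bookkeeping proved here)] -/
theorem hundredfortyseventh_holds_top :
    (canon₁₄₇ νtop True).MHThm351 ∧ (canon₁₄₇ νtop True).MHThm361 ∧ (canon₁₄₇ νtop True).MHProp362 ∧ (canon₁₄₇ νtop True).MHThm421 ∧ (canon₁₄₇ νtop True).MHCor422 ∧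
      (canon₁₄₇ νtop True).MHThm423 ∧ (canon₁₃ νtop κtop).MRpadicOrth :=
  hundredfortyseventh_of_inputs (canon_implications₁₄₇ νtop μtop κtop True) (canon_implications₄₅ νtop μtop κtop) (canon_implications νtop μtop κtop) bookInputs_top True.intro

/-- BOOK SIDE, EXACT SUPPORTS AS TYPED: in the book countermodel of ANY of the 24 leaves `l` (the node granted; all seven edges valid) the three ARCHIMEDEAN statements FAIL (`not_B_cm`: every
book leaf is load-bearing for Théorème 4.2.1, Corollaire 4.2.2, Théorème 4.2.3) while the three GLOBAL statements HOLD — Théorème 3.6.1's multiplicity one consumes no leaf of the book.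
[cite: Moeglin2017ArchUnipotentHowe, Thm 4.2.1 with p0029:L1, Thm 3.6.1 with p0027:L6-22 (bookkeeping proved here)] -/
theorem c147_book_cm (l : LeafSupport.Leaf) :
    ¬ (LeafSupport.mkN (LeafSupport.cm l)).leaf l ∧
      Implications147 (LeafSupport.mkN (LeafSupport.cm l)) (canon (LeafSupport.mkN (LeafSupport.cm l)) μtop κtop) (canon₁₃ (LeafSupport.mkN (LeafSupport.cm l)) κtop)
        (canon₄₅ (LeafSupport.mkN (LeafSupport.cm l))) (canon₁₄₇ (LeafSupport.mkN (LeafSupport.cm l)) True) ∧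
      (¬ (canon₁₄₇ (LeafSupport.mkN (LeafSupport.cm l)) True).MHThm421 ∧ ¬ (canon₁₄₇ (LeafSupport.mkN (LeafSupport.cm l)) True).MHCor422 ∧
        ¬ (canon₁₄₇ (LeafSupport.mkN (LeafSupport.cm l)) True).MHThm423) ∧
      ((canon₁₄₇ (LeafSupport.mkN (LeafSupport.cm l)) True).MHThm351 ∧ (canon₁₄₇ (LeafSupport.mkN (LeafSupport.cm l)) True).MHThm361 ∧
        (canon₁₄₇ (LeafSupport.mkN (LeafSupport.cm l)) True).MHProp362) :=
  have nb := not_B_cm l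
  ⟨(LeafSupport.countermodel l).2.2.1, canon_implications₁₄₇ _ _ _ _, ⟨fun h => nb h.1, fun h => nb h.1, fun h => nb h.1⟩, ⟨True.intro, True.intro, True.intro⟩⟩

/-- THE NODE IS LOAD-BEARING FOR ALL SIX STATEMENTS: with `MHThetaHyp` denied (book at the top; all seven edges valid) the three global AND the three archimedean statements FAIL — the
admitted theta criterion sits under every typed statement of the row. [cite: Moeglin2017ArchUnipotentHowe, p0002:L37-42, p0025:L1-3 (bookkeeping proved here)] -/
theorem c147_node_denied :
    Implications147 νtop (canon νtop μtop κtop) (canon₁₃ νtop κtop) (canon₄₅ νtop) (canon₁₄₇ νtop False) ∧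
      ¬ (canon₁₄₇ νtop False).MHThm351 ∧ ¬ (canon₁₄₇ νtop False).MHThm361 ∧ ¬ (canon₁₄₇ νtop False).MHProp362 ∧
      ¬ (canon₁₄₇ νtop False).MHThm421 ∧ ¬ (canon₁₄₇ νtop False).MHCor422 ∧ ¬ (canon₁₄₇ νtop False).MHThm423 :=
  ⟨canon_implications₁₄₇ _ _ _ _, fun h => h, fun h => h, fun h => h, fun h => h.2, fun h => h.2, fun h => h.2⟩

/-- THE TWO MULTIPLICITY-ONE THEOREMS OF THE MŒGLIN LINE SIDE BY SIDE: in the book countermodel of ANY leaf `l` row B75's p-adic multiplicity one for quasi-split Sp / SO / O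
(`MoeglinMult1qs`, section 47's `canon₄₅`: book-fed) FAILS while row B128's global multiplicity one for regular quadratic unipotent parameters (`MHThm361`, node granted) HOLDS.
[cite: Moeglin2011Mult1, Thm 2.5.1; Moeglin2017ArchUnipotentHowe, Thm 3.6.1 (bookkeeping proved here)] -/
theorem c147_vs_b75 (l : LeafSupport.Leaf) :
    ¬ (canon₄₅ (LeafSupport.mkN (LeafSupport.cm l))).MoeglinMult1qs ∧ (canon₁₄₇ (LeafSupport.mkN (LeafSupport.cm l)) True).MHThm361 :=
  ⟨not_B_cm l, True.intro⟩

/-- ROW A8-p UNDER THE RE-ISSUE: the re-issued edge holds in section 13's reading for every value of the node, and A8-p's orthogonal statements keep section 13's support — at the top they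
hold, in the book countermodel of any leaf they fail (the landed edge `E_MRpadicOrth`, book ∧ `StabInner` ∧ `TaibiInner`, is the stronger edge; the re-issue only displays the binder).
[cite: MoeglinRenard2018, §3.1, §4.2 (bookkeeping proved here)] -/
theorem c147_mrOrth_reissue (l : LeafSupport.Leaf) (p : Prop) :
    E_MRpadicOrthM νtop (canon νtop μtop κtop) (canon₁₃ νtop κtop) (canon₁₄₇ νtop p) ∧ (canon₁₃ νtop κtop).MRpadicOrth ∧
      ¬ (canon₁₃ (LeafSupport.mkN (LeafSupport.cm l)) κtop).MRpadicOrth :=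
  ⟨(canon_implications₁₄₇ νtop μtop κtop p).mrOrthM, hundredfortyseventh_holds_top.2.2.2.2.2.2, fun h => not_B_cm l h.1⟩

/-- THE HUNDRED-AND-FORTY-SEVENTH TRANCHE REGRADED, in one statement: (i) at the top all six statements of B128 hold; (ii) in the book countermodel of ANY of the 24 leaves the three
archimedean statements FAIL and the three global statements HOLD; (iii) with the node denied all six FAIL.  Supports: support(`MHThm351`) = support(`MHThm361`) = support(`MHProp362`) =
the node `MHThetaHyp` ALONE — no leaf of the book, of Mok's memoir or of KMSW; support(`MHThm421`) = support(`MHCor422`) = support(`MHThm423`) = all 24 book leaves (the seven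
2024–2026 preprint leaves and the two unwritten weighted fundamental lemmas included) ∧ the node.  In 2026 terms: Mœglin's archimedean special unipotent packets (stability,
multiplicity-freeness, irreducibility over ℂ) are conditional on the book's preprint layer and the two weighted lemmas (no sentence in the text) and on the paper's own admitted theta
criterion (printed twice); her global multiplicity one for Sp, Mp, O on that criterion alone. [cite: Moeglin2017ArchUnipotentHowe, Thms 3.5.1, 3.6.1, Prop. 3.6.2, Thm 4.2.1, Cor. 4.2.2, Thm 4.2.3 (bookkeeping proved here)] -/
theorem c147_regraded :
    ((canon₁₄₇ νtop True).MHThm361 ∧ (canon₁₄₇ νtop True).MHThm421 ∧ (canon₁₄₇ νtop True).MHCor422 ∧ (canon₁₄₇ νtop True).MHThm423) ∧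
      (∀ l : LeafSupport.Leaf, ¬ (LeafSupport.mkN (LeafSupport.cm l)).leaf l ∧ ¬ (canon₁₄₇ (LeafSupport.mkN (LeafSupport.cm l)) True).MHThm421 ∧
        ¬ (canon₁₄₇ (LeafSupport.mkN (LeafSupport.cm l)) True).MHThm423 ∧ (canon₁₄₇ (LeafSupport.mkN (LeafSupport.cm l)) True).MHThm361) ∧
      (¬ (canon₁₄₇ νtop False).MHThm361 ∧ ¬ (canon₁₄₇ νtop False).MHThm421) :=
  ⟨⟨hundredfortyseventh_holds_top.2.1, hundredfortyseventh_holds_top.2.2.2.1, hundredfortyseventh_holds_top.2.2.2.2.1, hundredfortyseventh_holds_top.2.2.2.2.2.1⟩,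
    fun l => have h := c147_book_cm l
      ⟨h.1, h.2.2.1.1, h.2.2.1.2.2, h.2.2.2.2.1⟩,
    ⟨c147_node_denied.2.2.1, c147_node_denied.2.2.2.2.1⟩⟩

/-! ## 150. Hundred-and-forty-eighth tranche (v2 of this file, after `Downstream41.lean` v2; unit `pub-arthur-down-g65`): supports of row B129 C. Mœglin – D. Renard, Contemp. Math. 691 (2017)
203–256 = arXiv:1604.07328 (`MRCProp65` = Proposition 6.5 ⇐ the book at every rank; `MRCThm612` = Théorème 6.12 ⇐ Prop. 6.5 ∧ row B128's Thm 4.2.3; `MRCThm101` = Théorème 10.1 ⇐ the book ∧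
B128's Cor. 4.2.2 / Thm 4.2.3 / Thm 3.5.1 ∧ Thm 6.12; `MRCThm114` = Théorème 11.4 ⇐ Thm 6.12; `MRCCor123` = Corollaire 12.3 ⇐ Thm 6.12 ∧ Thm 10.1) — read against section 149's `canon₁₄₇ ν p`
(B128's node := `p`). -/

section Canon148

variable (ν : Nodes) (p : Prop)

/-- The parametrised canonical reading of the hundred-and-forty-eighth tranche: Proposition 6.5 := the book at every rank; the four other statements := the book ∧ `p` (B128's node).
[cite: MoeglinRenard2017Complexes, Prop. 6.5, Thms 6.12, 10.1, 11.4, Cor. 12.3 (canonical model; bookkeeping)] -/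
abbrev canon₁₄₈ : Consumers148 where
  MRCProp65 := ∀ N, ν.Everything N
  MRCThm612 := (∀ N, ν.Everything N) ∧ p
  MRCThm101 := (∀ N, ν.Everything N) ∧ p
  MRCThm114 := (∀ N, ν.Everything N) ∧ p
  MRCCor123 := (∀ N, ν.Everything N) ∧ p

/-- All five hundred-and-forty-eighth-tranche edges hold in the canonical reading, read against section 149's `canon₁₄₇ ν p`, for arbitrary ν, p. [cite: MoeglinRenard2017Complexes, Prop. 6.5, Thms 6.12, 10.1, 11.4, Cor. 12.3 (bookkeeping proved here)] -/
theorem canon_implications₁₄₈ : Implications148 ν (canon₁₄₇ ν p) (canon₁₄₈ ν p) where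
  prop65 := fun b => b
  thm612 := fun b h => ⟨b, h.2⟩
  thm101 := fun b _ _ h _ => ⟨b, h⟩
  thm114 := fun h => h
  cor123 := fun h _ => h

end Canon148

/-- At the top (every input of the book's DAG; B128's node granted) all five statements of row B129 hold — through the tranche's own `hundredfortyeighth_of_inputs` fed by `bookInputs_top`,
section 149's `canon_implications₁₄₇`, section 47's `canon_implications₄₅`. [cite: MoeglinRenard2017Complexes, Prop. 6.5, Thms 6.12, 10.1, 11.4, Cor. 12.3 (bookkeeping proved here)] -/
theorem hundredfortyeighth_holds_top :
    (canon₁₄₈ νtop True).MRCProp65 ∧ (canon₁₄₈ νtop True).MRCThm612 ∧ (canon₁₄₈ νtop True).MRCThm101 ∧ (canon₁₄₈ νtop True).MRCThm114 ∧ (canon₁₄₈ νtop True).MRCCor123 :=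
  hundredfortyeighth_of_inputs (canon_implications₁₄₈ νtop True) (canon_implications₁₄₇ νtop μtop κtop True) (canon_implications₄₅ νtop μtop κtop) bookInputs_top True.intro

/-- BOOK SIDE, EXACT SUPPORTS AS TYPED: in the book countermodel of ANY of the 24 leaves `l` (B128's node granted; all five edges valid) each of B129's five statements FAILS (`not_B_cm`): every
book leaf is load-bearing for Mœglin – Renard's description of the complex Arthur packets, Proposition 6.5 included. [cite: MoeglinRenard2017Complexes, Prop. 6.5 with p0015:L57-62, Thm 10.1 with p0035:L52-53 (bookkeeping proved here)] -/
theorem c148_book_cm (l : LeafSupport.Leaf) :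
    ¬ (LeafSupport.mkN (LeafSupport.cm l)).leaf l ∧
      Implications148 (LeafSupport.mkN (LeafSupport.cm l)) (canon₁₄₇ (LeafSupport.mkN (LeafSupport.cm l)) True) (canon₁₄₈ (LeafSupport.mkN (LeafSupport.cm l)) True) ∧
      ¬ (canon₁₄₈ (LeafSupport.mkN (LeafSupport.cm l)) True).MRCProp65 ∧ ¬ (canon₁₄₈ (LeafSupport.mkN (LeafSupport.cm l)) True).MRCThm612 ∧
      ¬ (canon₁₄₈ (LeafSupport.mkN (LeafSupport.cm l)) True).MRCThm101 ∧ ¬ (canon₁₄₈ (LeafSupport.mkN (LeafSupport.cm l)) True).MRCThm114 ∧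
      ¬ (canon₁₄₈ (LeafSupport.mkN (LeafSupport.cm l)) True).MRCCor123 :=
  have nb := not_B_cm l
  ⟨(LeafSupport.countermodel l).2.2.1, canon_implications₁₄₈ _ _, nb, fun h => nb h.1, fun h => nb h.1, fun h => nb h.1, fun h => nb h.1⟩

/-- B128's NODE IS LOAD-BEARING FOR EVERYTHING PAST PROPOSITION 6.5: with `MHThetaHyp` denied (book at the top; all five edges valid, section 149's `canon₁₄₇ νtop False` on B128's side)
Proposition 6.5 HOLDS while Théorèmes 6.12, 10.1, 11.4 and Corollaire 12.3 FAIL — the admitted theta criterion of Progr. Math. 323 travels into Contemp. Math. 691 through « [pourhowe] ».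
[cite: MoeglinRenard2017Complexes, Rem. 3.6 (p0010:L80-91); Moeglin2017ArchUnipotentHowe, p0002:L37-42 (bookkeeping proved here)] -/
theorem c148_node_denied :
    Implications148 νtop (canon₁₄₇ νtop False) (canon₁₄₈ νtop False) ∧ (canon₁₄₈ νtop False).MRCProp65 ∧
      ¬ (canon₁₄₈ νtop False).MRCThm612 ∧ ¬ (canon₁₄₈ νtop False).MRCThm101 ∧ ¬ (canon₁₄₈ νtop False).MRCThm114 ∧ ¬ (canon₁₄₈ νtop False).MRCCor123 :=
  ⟨canon_implications₁₄₈ _ _, bookInputs_top.everything, fun h => h.2, fun h => h.2, fun h => h.2, fun h => h.2⟩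

/-- B128 AND B129 SIDE BY SIDE: in the book countermodel of ANY leaf B128's archimedean Thm 4.2.3 and B129's identification Thm 10.1 fail TOGETHER while B128's global Thm 3.6.1 holds; with the
node denied both fail; at the top both hold. [cite: Moeglin2017ArchUnipotentHowe, Thms 3.6.1, 4.2.3; MoeglinRenard2017Complexes, Thm 10.1 (bookkeeping proved here)] -/
theorem c148_with_b128 (l : LeafSupport.Leaf) :
    (¬ (canon₁₄₇ (LeafSupport.mkN (LeafSupport.cm l)) True).MHThm423 ∧ ¬ (canon₁₄₈ (LeafSupport.mkN (LeafSupport.cm l)) True).MRCThm101 ∧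
        (canon₁₄₇ (LeafSupport.mkN (LeafSupport.cm l)) True).MHThm361) ∧
      (¬ (canon₁₄₇ νtop False).MHThm423 ∧ ¬ (canon₁₄₈ νtop False).MRCThm101) ∧
      ((canon₁₄₇ νtop True).MHThm423 ∧ (canon₁₄₈ νtop True).MRCThm101) :=
  have nb := not_B_cm l
  ⟨⟨fun h => nb h.1, fun h => nb h.1, True.intro⟩, ⟨fun h => h.2, fun h => h.2⟩, ⟨hundredfortyseventh_holds_top.2.2.2.2.2.1, hundredfortyeighth_holds_top.2.2.1⟩⟩

/-- THE HUNDRED-AND-FORTY-EIGHTH TRANCHE REGRADED, in one statement: (i) at the top all five statements hold; (ii) in the book countermodel of ANY of the 24 leaves all five FAIL; (iii) with B128's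
node denied Proposition 6.5 HOLDS and the four others FAIL.  Supports: support(`MRCProp65`) = all 24 book leaves, no node; support(`MRCThm612`) = support(`MRCThm101`) = support(`MRCThm114`) =
support(`MRCCor123`) = the 24 leaves (the seven 2024–2026 preprint leaves and the two unwritten weighted fundamental lemmas included) ∧ row B128's node `MHThetaHyp`; nothing of Mok / KMSW.  In
2026 terms: Mœglin – Renard's determination of the Arthur packets of the complex classical groups (reduction to good-parity unipotent packets, identification with Barbasch – Vogan, singleton
packets at regular infinitesimal character, wavefront sets) is conditional on the book's preprint layer and the two weighted lemmas (no sentence in the text) and, through « [pourhowe] »,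
on Mœglin's admitted theta criterion. [cite: MoeglinRenard2017Complexes, Prop. 6.5, Thms 6.12, 10.1, 11.4, Cor. 12.3 (bookkeeping proved here)] -/
theorem c148_regraded :
    ((canon₁₄₈ νtop True).MRCProp65 ∧ (canon₁₄₈ νtop True).MRCThm612 ∧ (canon₁₄₈ νtop True).MRCThm101 ∧ (canon₁₄₈ νtop True).MRCThm114 ∧ (canon₁₄₈ νtop True).MRCCor123) ∧
      (∀ l : LeafSupport.Leaf, ¬ (LeafSupport.mkN (LeafSupport.cm l)).leaf l ∧ ¬ (canon₁₄₈ (LeafSupport.mkN (LeafSupport.cm l)) True).MRCProp65 ∧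
        ¬ (canon₁₄₈ (LeafSupport.mkN (LeafSupport.cm l)) True).MRCThm101) ∧
      ((canon₁₄₈ νtop False).MRCProp65 ∧ ¬ (canon₁₄₈ νtop False).MRCThm101 ∧ ¬ (canon₁₄₈ νtop False).MRCCor123) :=
  ⟨hundredfortyeighth_holds_top,
    fun l => have h := c148_book_cm l
      ⟨h.1, h.2.2.1, h.2.2.2.2.1⟩,
    ⟨c148_node_denied.2.1, c148_node_denied.2.2.2.1, c148_node_denied.2.2.2.2.2⟩⟩

/-! ## 151. Hundred-and-forty-ninth tranche (v3 of this file, after `Downstream42.lean` v1 — NEW register file M306, hence the added `import …Downstream42`; unit `pub-arthur-down-g66`):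
supports of row B130 C. Mœglin – D. Renard, Nagoya Math. J. 241 (2021) 44–124 = arXiv:1802.04611 (fifteen typed statements; edges: `MRHCor93` ⇐ book; `MRHThm62` ⇐ B1 ∧ A8 (both
book-fed); `MRHProp102` ⇐ A8 ∧ B68; `MRHProp162` ⇐ book ∧ B110 ∧ B70; `MRHThm164` / `MRHThm51` / `MRHProp176` ⇐ book ∧ upstream; `MRHProp86` ⇐ A8 ∧ Thm 5.1; `MRHThm72` ⇐ A8 ∧ 5.1 ∧ 8.6
∧ 10.2; `MRHCor202` ⇐ book ∧ A3 ∧ A8 ∧ 5.1 ∧ B70 ∧ B128's Thm 3.6.1; `MRHThm87` ⇐ 8.6 ∧ 9.3 ∧ 20.2; `MRHThm71` ⇐ A8 ∧ B128's Cor. 4.2.2 ∧ B68 ∧ 5.1 ∧ 8.6 ∧ 9.3 ∧ 10.2 ∧ 20.2;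
`MRHThm175` ⇐ 16.4 ∧ 17.6 ∧ 16.2 ∧ B70 ∧ B110 ∧ B128's Cor. 4.2.2 ∧ B68; `MRHProp181` ⇐ 17.5; `MRHProp183` ⇐ 18.1 ∧ 7.2 ∧ A8) and of row C55 under the re-issue `E_AtobeSiegelAMFM` — a
reading parametrised by B128's node `p` (section 149's `canon₁₄₇ ν p`) and by the value `r` of row B70's `MoeglinElementary`, the entrance of C. Mœglin's p-adic series: the edges are
proved for ARBITRARY `Consumers48` / `Consumers54` assignments with `r := c₄₈.MoeglinElementary`, so that the same bundle is read against section 50's `canon₄₈ ν` (B75's node granted)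
and against its denied-remainder companion `canon₄₈noR ν` (sections 50 / 54).  Rows A8, B1, A3 keep sections 1 / 2's book values, B68 section 53's `canon₅₃`, C55 section 33's
`canon₃₃` (book). -/

section Canon149

variable (ν : Nodes) (μ : Mok2015.Nodes) (κ : KMSW2014.Nodes) (p r : Prop)

/-- The parametrised canonical reading of the hundred-and-forty-ninth tranche: Cor. 9.3, Thm 6.2 := the book at every rank; Prop. 10.2 := the book ∧ B68's value; Prop. 16.2, Thm 16.4,
Thm 5.1, Prop. 17.6, Prop. 8.6 := the book ∧ `r`; Thm 8.7, Cor. 20.2 := (book ∧ `r`) ∧ `p`; Thm 7.2 := (book ∧ `r`) ∧ B68; Thms 7.1, 17.5, Props 18.1, 18.3/18.5 := (book ∧ `r`) ∧ `p` ∧ B68.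
[cite: MoeglinRenard2021HighestWeight, Thms 5.1–8.7, Cor. 9.3, Prop. 10.2, §§16–20 (canonical model; bookkeeping)] -/
abbrev canon₁₄₉ : Consumers149 where
  MRHThm51 := (∀ N, ν.Everything N) ∧ r
  MRHThm62 := ∀ N, ν.Everything N
  MRHThm71 := ((∀ N, ν.Everything N) ∧ r) ∧ p ∧ (canon₅₃ ν μ κ).MRtranslation
  MRHThm72 := ((∀ N, ν.Everything N) ∧ r) ∧ (canon₅₃ ν μ κ).MRtranslation
  MRHProp86 := (∀ N, ν.Everything N) ∧ r
  MRHThm87 := ((∀ N, ν.Everything N) ∧ r) ∧ p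
  MRHCor93 := ∀ N, ν.Everything N
  MRHProp102 := (∀ N, ν.Everything N) ∧ (canon₅₃ ν μ κ).MRtranslation
  MRHProp162 := (∀ N, ν.Everything N) ∧ r
  MRHThm164 := (∀ N, ν.Everything N) ∧ r
  MRHThm175 := ((∀ N, ν.Everything N) ∧ r) ∧ p ∧ (canon₅₃ ν μ κ).MRtranslation
  MRHProp176 := (∀ N, ν.Everything N) ∧ r
  MRHProp181 := ((∀ N, ν.Everything N) ∧ r) ∧ p ∧ (canon₅₃ ν μ κ).MRtranslation
  MRHProp183 := ((∀ N, ν.Everything N) ∧ r) ∧ p ∧ (canon₅₃ ν μ κ).MRtranslation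
  MRHCor202 := ((∀ N, ν.Everything N) ∧ r) ∧ p

variable (c₄₈ : Consumers48) (c₅₄ : Consumers54)

/-- All sixteen hundred-and-forty-ninth-tranche edges hold in the canonical reading with `r := c₄₈.MoeglinElementary`, for ARBITRARY ν, μ, κ, p and arbitrary tranche-48 / 54 assignments c₄₈,
c₅₄ (B110's value enters no field: the edge `E_MRHProp162` consumes it together with B70's, and the canonical model keeps the weaker conjunct), read against sections 1, 2, 33, 53, 149.
[cite: MoeglinRenard2021HighestWeight, Thms 5.1–8.7, Cor. 9.3, Prop. 10.2, §§16–20; Atobe2018SiegelAMF, Prop. 3.3 (bookkeeping proved here)] -/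
theorem canon_implications₁₄₉ :
    Implications149 ν (canon ν μ κ) (canon₂ ν μ κ) (canon₃₃ ν μ κ) c₄₈ (canon₅₃ ν μ κ) c₅₄ (canon₁₄₇ ν p) (canon₁₄₉ ν μ κ p c₄₈.MoeglinElementary) where
  cor93 := fun b => b
  prop162 := fun b _ h => ⟨b, h⟩
  thm164 := fun _ h => h
  thm51 := fun _ h => h
  prop176 := fun _ h => h
  thm175 := fun h _ _ _ _ h4 t => ⟨h, h4.2, t⟩
  cor202 := fun _ _ _ h _ hp => ⟨h, hp⟩
  prop102 := fun b t => ⟨b, t⟩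
  prop86 := fun _ h => h
  thm62 := fun b _ => b
  thm71 := fun _ h4 t h51 _ _ _ _ => ⟨h51, h4.2, t⟩
  thm72 := fun _ h _ h102 => ⟨h, h102.2⟩
  thm87 := fun _ _ h => h
  prop181 := fun h => h
  prop183 := fun h _ _ => h
  atobeM := fun b _ _ _ => b

end Canon149

/-- The reading AT THE TOP: every atom of the three DAGs true, B128's node granted, B70's value that of section 50's `canon₄₈ νtop` (B75's node granted inside it).
[cite: MoeglinRenard2021HighestWeight, Thm 7.1 (canonical model; bookkeeping)] -/
abbrev top₁₄₉ : Consumers149 := canon₁₄₉ νtop μtop κtop True (canon₄₈ νtop).MoeglinElementary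

/-- At the top all fifteen statements of row B130 hold, and C55 under the re-issue — through the tranche's own `hundredfortyninth_of_inputs` fed by `bookInputs_top` and the canonical edge
bundles of sections 1, 2, 13, 47, 50, 53, 54, 149 (tranches 1, 2, 13, 45, 47, 48, 53, 54, 147). [cite: MoeglinRenard2021HighestWeight, Thms 5.1–8.7, Cor. 9.3, Prop. 10.2, §§16–20; Atobe2018SiegelAMF, Prop. 3.3 (bookkeeping proved here)] -/
theorem hundredfortyninth_holds_top : ((top₁₄₉).MRHThm51 ∧ (top₁₄₉).MRHThm62 ∧ (top₁₄₉).MRHThm71 ∧ (top₁₄₉).MRHThm72 ∧ (top₁₄₉).MRHProp86 ∧ (top₁₄₉).MRHThm87 ∧ (top₁₄₉).MRHCor93 ∧ (top₁₄₉).MRHProp102 ∧ (top₁₄₉).MRHProp162 ∧ (top₁₄₉).MRHThm164 ∧ (top₁₄₉).MRHThm175 ∧ (top₁₄₉).MRHProp176 ∧ (top₁₄₉).MRHProp181 ∧ (top₁₄₉).MRHProp183 ∧ (top₁₄₉).MRHCor202) ∧ (canon₃₃ νtop μtop κtop).AtobeSiegelAMF :=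
  have b : ∀ N, νtop.Everything N := bookInputs_top.everything
  hundredfortyninth_of_inputs (canon_implications₁₄₉ νtop μtop κtop True (canon₄₈ νtop) (canon₅₄ νtop)) (canon_implications νtop μtop κtop) (canon_implications₂ νtop μtop κtop)
    (canon_implications₁₃ νtop μtop κtop) (canon_implications₅₃ νtop μtop κtop) (canon_implications₄₅ νtop μtop κtop) (canon_implications₄₇ νtop) (canon_implications₄₈ νtop)
    (canon_implications₅₄ νtop μtop κtop) (canon_implications₁₄₇ νtop μtop κtop True) bookInputs_top ⟨b, trivial⟩ b trivial

/-- BOOK SIDE, EXACT SUPPORTS AS TYPED: in the book countermodel of ANY of the 24 leaves `l` (B128's node granted; B70 read by section 50's `canon₄₈` of that model; all sixteen edges valid) EVERY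
statement of row B130 FAILS (`not_B_cm`) — Corollaire 9.3 and Théorème 6.2 through the book alone, Proposition 10.2 through A8 / B68, the twelve others through the book conjunct they all
carry — and C55 fails with them: every book leaf is load-bearing for the whole row. [cite: MoeglinRenard2021HighestWeight, Cor. 9.3 with p0022:L45-48, Thm 16.4 with p0037:L29-33, §20 with p0045:L52-54 (bookkeeping proved here)] -/
theorem c149_book_cm (l : LeafSupport.Leaf) :
    ¬ (LeafSupport.mkN (LeafSupport.cm l)).leaf l ∧
      Implications149 (LeafSupport.mkN (LeafSupport.cm l)) (canon (LeafSupport.mkN (LeafSupport.cm l)) μtop κtop) (canon₂ (LeafSupport.mkN (LeafSupport.cm l)) μtop κtop) (canon₃₃ (LeafSupport.mkN (LeafSupport.cm l)) μtop κtop) (canon₄₈ (LeafSupport.mkN (LeafSupport.cm l)))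
        (canon₅₃ (LeafSupport.mkN (LeafSupport.cm l)) μtop κtop) (canon₅₄ (LeafSupport.mkN (LeafSupport.cm l))) (canon₁₄₇ (LeafSupport.mkN (LeafSupport.cm l)) True) (canon₁₄₉ (LeafSupport.mkN (LeafSupport.cm l)) μtop κtop True (canon₄₈ (LeafSupport.mkN (LeafSupport.cm l))).MoeglinElementary) ∧
      (¬ (canon₁₄₉ (LeafSupport.mkN (LeafSupport.cm l)) μtop κtop True (canon₄₈ (LeafSupport.mkN (LeafSupport.cm l))).MoeglinElementary).MRHCor93 ∧ ¬ (canon₁₄₉ (LeafSupport.mkN (LeafSupport.cm l)) μtop κtop True (canon₄₈ (LeafSupport.mkN (LeafSupport.cm l))).MoeglinElementary).MRHThm62 ∧ ¬ (canon₁₄₉ (LeafSupport.mkN (LeafSupport.cm l)) μtop κtop True (canon₄₈ (LeafSupport.mkN (LeafSupport.cm l))).MoeglinElementary).MRHProp102) ∧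
      (¬ (canon₁₄₉ (LeafSupport.mkN (LeafSupport.cm l)) μtop κtop True (canon₄₈ (LeafSupport.mkN (LeafSupport.cm l))).MoeglinElementary).MRHThm51 ∧ ¬ (canon₁₄₉ (LeafSupport.mkN (LeafSupport.cm l)) μtop κtop True (canon₄₈ (LeafSupport.mkN (LeafSupport.cm l))).MoeglinElementary).MRHThm71 ∧ ¬ (canon₁₄₉ (LeafSupport.mkN (LeafSupport.cm l)) μtop κtop True (canon₄₈ (LeafSupport.mkN (LeafSupport.cm l))).MoeglinElementary).MRHThm72 ∧ ¬ (canon₁₄₉ (LeafSupport.mkN (LeafSupport.cm l)) μtop κtop True (canon₄₈ (LeafSupport.mkN (LeafSupport.cm l))).MoeglinElementary).MRHThm87 ∧ ¬ (canon₁₄₉ (LeafSupport.mkN (LeafSupport.cm l)) μtop κtop True (canon₄₈ (LeafSupport.mkN (LeafSupport.cm l))).MoeglinElementary).MRHThm164 ∧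
        ¬ (canon₁₄₉ (LeafSupport.mkN (LeafSupport.cm l)) μtop κtop True (canon₄₈ (LeafSupport.mkN (LeafSupport.cm l))).MoeglinElementary).MRHThm175 ∧ ¬ (canon₁₄₉ (LeafSupport.mkN (LeafSupport.cm l)) μtop κtop True (canon₄₈ (LeafSupport.mkN (LeafSupport.cm l))).MoeglinElementary).MRHProp183 ∧ ¬ (canon₁₄₉ (LeafSupport.mkN (LeafSupport.cm l)) μtop κtop True (canon₄₈ (LeafSupport.mkN (LeafSupport.cm l))).MoeglinElementary).MRHCor202) ∧
      ¬ (canon₃₃ (LeafSupport.mkN (LeafSupport.cm l)) μtop κtop).AtobeSiegelAMF :=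
  have nb := not_B_cm l
  ⟨(LeafSupport.countermodel l).2.2.1, canon_implications₁₄₉ _ _ _ _ _ _, ⟨nb, nb, fun h => nb h.1⟩,
    ⟨fun h => nb h.1, fun h => nb h.1.1, fun h => nb h.1.1, fun h => nb h.1.1, fun h => nb h.1, fun h => nb h.1.1, fun h => nb h.1.1, fun h => nb h.1.1⟩, nb⟩

/-- B70's VALUE AND B68's VALUE AT THE TOP, extracted from the top theorem (Thm 5.1's and Prop. 10.2's canonical values). [cite: MoeglinRenard2021HighestWeight, Thm 5.1, Prop. 10.2 (bookkeeping proved here)] -/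
theorem c149_inputs_top : (canon₄₈ νtop).MoeglinElementary ∧ (canon₅₃ νtop μtop κtop).MRtranslation :=
  ⟨hundredfortyninth_holds_top.1.1.2, hundredfortyninth_holds_top.1.2.2.2.2.2.2.2.1.2⟩

/-- B128's NODE IS LOAD-BEARING FOR THÉORÈMES 7.1, 8.7, 17.5, §18 AND COROLLAIRE 20.2 — AND FOR NOTHING ELSE: with `MHThetaHyp` denied (book at the top, B70 at its top value; all sixteen edges valid,
section 149's `canon₁₄₇ νtop False` on B128's side) Théorèmes 5.1, 6.2, 7.2, Prop. 8.6, Cor. 9.3, Props 10.2, 16.2, Thm 16.4, Prop. 17.6 HOLD while Théorèmes 7.1, 8.7, 17.5, Props 18.1, 18.3/18.5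
and Cor. 20.2 FAIL — the admitted theta criterion of Progr. Math. 323 travels into Nagoya Math. J. 241 through « (voir [pourhowe] et [MR5]) », « ψ = ψ_u ([pourhowe]) » and « La méthode de
[pourhowe] ». [cite: MoeglinRenard2021HighestWeight, §4.4 (p0015:L2-3), §13 (p0031:L5), §20 (p0047:L2-4); Moeglin2017ArchUnipotentHowe, p0002:L37-42 (bookkeeping proved here)] -/
theorem c149_b128_denied :
    Implications149 νtop (canon νtop μtop κtop) (canon₂ νtop μtop κtop) (canon₃₃ νtop μtop κtop) (canon₄₈ νtop) (canon₅₃ νtop μtop κtop) (canon₅₄ νtop) (canon₁₄₇ νtop False) (canon₁₄₉ νtop μtop κtop False (canon₄₈ νtop).MoeglinElementary) ∧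
      ((canon₁₄₉ νtop μtop κtop False (canon₄₈ νtop).MoeglinElementary).MRHThm51 ∧ (canon₁₄₉ νtop μtop κtop False (canon₄₈ νtop).MoeglinElementary).MRHThm62 ∧ (canon₁₄₉ νtop μtop κtop False (canon₄₈ νtop).MoeglinElementary).MRHThm72 ∧ (canon₁₄₉ νtop μtop κtop False (canon₄₈ νtop).MoeglinElementary).MRHProp86 ∧ (canon₁₄₉ νtop μtop κtop False (canon₄₈ νtop).MoeglinElementary).MRHCor93 ∧ (canon₁₄₉ νtop μtop κtop False (canon₄₈ νtop).MoeglinElementary).MRHProp102 ∧ (canon₁₄₉ νtop μtop κtop False (canon₄₈ νtop).MoeglinElementary).MRHProp162 ∧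
        (canon₁₄₉ νtop μtop κtop False (canon₄₈ νtop).MoeglinElementary).MRHThm164 ∧ (canon₁₄₉ νtop μtop κtop False (canon₄₈ νtop).MoeglinElementary).MRHProp176) ∧
      (¬ (canon₁₄₉ νtop μtop κtop False (canon₄₈ νtop).MoeglinElementary).MRHThm71 ∧ ¬ (canon₁₄₉ νtop μtop κtop False (canon₄₈ νtop).MoeglinElementary).MRHThm87 ∧ ¬ (canon₁₄₉ νtop μtop κtop False (canon₄₈ νtop).MoeglinElementary).MRHThm175 ∧ ¬ (canon₁₄₉ νtop μtop κtop False (canon₄₈ νtop).MoeglinElementary).MRHProp181 ∧ ¬ (canon₁₄₉ νtop μtop κtop False (canon₄₈ νtop).MoeglinElementary).MRHProp183 ∧ ¬ (canon₁₄₉ νtop μtop κtop False (canon₄₈ νtop).MoeglinElementary).MRHCor202) :=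
  have b : ∀ N, νtop.Everything N := bookInputs_top.everything
  have r := c149_inputs_top.1
  have t := c149_inputs_top.2
  ⟨canon_implications₁₄₉ _ _ _ _ _ _, ⟨⟨b, r⟩, b, ⟨⟨b, r⟩, t⟩, ⟨b, r⟩, b, ⟨b, t⟩, ⟨b, r⟩, ⟨b, r⟩, ⟨b, r⟩⟩,
    ⟨fun h => h.2.1, fun h => h.2, fun h => h.2.1, fun h => h.2.1, fun h => h.2.1, fun h => h.2⟩⟩

/-- THE p-ADIC MŒGLIN SERIES IS LOAD-BEARING FOR EVERYTHING PAST COR. 9.3 / THM 6.2 / PROP. 10.2: with B75's remainder DENIED on the series' side (sections 50 / 54's `canon₄₈noR` / `canon₅₄noR`: B70's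
value contains `False`; book and B128's node at the top; all sixteen edges valid) Cor. 9.3, Thm 6.2 and Prop. 10.2 HOLD while the twelve other statements FAIL — « [elementaire] » and « la filtration
de Kudla » ([pourkudla]) sit under Proposition 16.2, hence under Théorème 16.4, Théorème 5.1 and all that uses them. [cite: MoeglinRenard2021HighestWeight, Prop. 16.2 with p0035:L64-88, Thm 5.1 with p0016:L73-75; Moeglin2006Elementary, §2.1 (bookkeeping proved here)] -/
theorem c149_series_denied :
    Implications149 νtop (canon νtop μtop κtop) (canon₂ νtop μtop κtop) (canon₃₃ νtop μtop κtop) (canon₄₈noR νtop) (canon₅₃ νtop μtop κtop) (canon₅₄noR νtop) (canon₁₄₇ νtop True) (canon₁₄₉ νtop μtop κtop True (canon₄₈noR νtop).MoeglinElementary) ∧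
      ((canon₁₄₉ νtop μtop κtop True (canon₄₈noR νtop).MoeglinElementary).MRHCor93 ∧ (canon₁₄₉ νtop μtop κtop True (canon₄₈noR νtop).MoeglinElementary).MRHThm62 ∧ (canon₁₄₉ νtop μtop κtop True (canon₄₈noR νtop).MoeglinElementary).MRHProp102) ∧
      (¬ (canon₁₄₉ νtop μtop κtop True (canon₄₈noR νtop).MoeglinElementary).MRHProp162 ∧ ¬ (canon₁₄₉ νtop μtop κtop True (canon₄₈noR νtop).MoeglinElementary).MRHThm164 ∧ ¬ (canon₁₄₉ νtop μtop κtop True (canon₄₈noR νtop).MoeglinElementary).MRHThm51 ∧ ¬ (canon₁₄₉ νtop μtop κtop True (canon₄₈noR νtop).MoeglinElementary).MRHProp176 ∧ ¬ (canon₁₄₉ νtop μtop κtop True (canon₄₈noR νtop).MoeglinElementary).MRHThm175 ∧ ¬ (canon₁₄₉ νtop μtop κtop True (canon₄₈noR νtop).MoeglinElementary).MRHCor202 ∧ ¬ (canon₁₄₉ νtop μtop κtop True (canon₄₈noR νtop).MoeglinElementary).MRHProp86 ∧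
        ¬ (canon₁₄₉ νtop μtop κtop True (canon₄₈noR νtop).MoeglinElementary).MRHThm71 ∧ ¬ (canon₁₄₉ νtop μtop κtop True (canon₄₈noR νtop).MoeglinElementary).MRHThm72 ∧ ¬ (canon₁₄₉ νtop μtop κtop True (canon₄₈noR νtop).MoeglinElementary).MRHThm87 ∧ ¬ (canon₁₄₉ νtop μtop κtop True (canon₄₈noR νtop).MoeglinElementary).MRHProp181 ∧ ¬ (canon₁₄₉ νtop μtop κtop True (canon₄₈noR νtop).MoeglinElementary).MRHProp183) :=
  have b : ∀ N, νtop.Everything N := bookInputs_top.everything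
  have t := c149_inputs_top.2
  ⟨canon_implications₁₄₉ _ _ _ _ _ _, ⟨b, b, ⟨b, t⟩⟩,
    ⟨fun h => h.2.1.2, fun h => h.2.1.2, fun h => h.2.1.2, fun h => h.2.1.2, fun h => h.1.2.1.2, fun h => h.1.2.1.2, fun h => h.2.1.2,
      fun h => h.1.2.1.2, fun h => h.1.2.1.2, fun h => h.1.2.1.2, fun h => h.1.2.1.2, fun h => h.1.2.1.2⟩⟩

/-- ROW C55 UNDER THE RE-ISSUE: the re-issued edge holds in section 33's reading for every value of B128's node and of B70; C55 keeps section 33's support — at the top it holds, in the book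
countermodel of any leaf it fails (the landed edge `E_AtobeSiegelAMF`, book ∧ B1 ∧ B2, carries the same book premise; the re-issue only displays the [MR] binder, whose own value at the top
is the full conjunction). [cite: Atobe2018SiegelAMF, Prop. 3.3; MoeglinRenard2021HighestWeight, Thm 7.1 (bookkeeping proved here)] -/
theorem c149_c55_reissue (l : LeafSupport.Leaf) (p r : Prop) :
    E_AtobeSiegelAMFM νtop (canon νtop μtop κtop) (canon₂ νtop μtop κtop) (canon₃₃ νtop μtop κtop) (canon₁₄₉ νtop μtop κtop p r) ∧ (canon₃₃ νtop μtop κtop).AtobeSiegelAMF ∧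
      ¬ (canon₃₃ (LeafSupport.mkN (LeafSupport.cm l)) μtop κtop).AtobeSiegelAMF ∧ (top₁₄₉).MRHThm71 :=
  ⟨fun b _ _ _ => b, hundredfortyninth_holds_top.2, not_B_cm l, hundredfortyninth_holds_top.1.2.2.1⟩

/-- THE HUNDRED-AND-FORTY-NINTH TRANCHE REGRADED, in one statement: (i) at the top all fifteen statements of B130 hold (and C55); (ii) in the book countermodel of ANY of the 24 leaves Théorème 7.1,
Corollaire 9.3 and Corollaire 20.2 FAIL (all fifteen do: `c149_book_cm`); (iii) with B128's node denied Théorème 7.1 and Corollaire 20.2 FAIL while Théorème 7.2 and Corollaire 9.3 HOLD; (iv) with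
B75's remainder denied on the series' side Théorème 7.1 and Théorème 5.1 FAIL while Corollaire 9.3 and Proposition 10.2 HOLD.  Supports: support(`MRHCor93`) = support(`MRHThm62`) = all 24
book leaves; support(`MRHProp102`) = the 24 leaves (A8, B68 book-fed); support(`MRHThm51`, `MRHThm72`, `MRHProp86`, `MRHProp162`, `MRHThm164`, `MRHProp176`) = the 24 leaves ∧ B75's node
(through B70 / B110; the five published leaves of the series are book leaves); support(`MRHThm71`, `MRHThm87`, `MRHThm175`, `MRHProp181`, `MRHProp183`, `MRHCor202`) = the same ∧ B128's
node `MHThetaHyp`; nothing of Mok / KMSW.  In 2026 terms: Mœglin – Renard's determination of the Arthur packets of Sp(2n,ℝ) containing a scalar unitary highest weight module — the list,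
the multiplicity one, the characters ρ_π — is conditional on the book's 2024–2026 preprint layer and the two unwritten weighted fundamental lemmas (no sentence in the text), on the
announced results C. Mœglin's p-adic series admits (through [elementaire] / [pourkudla]) and, for the multiplicity-one and ρ_π statements, on the admitted theta criterion of [pourhowe].
[cite: MoeglinRenard2021HighestWeight, Thms 5.1–8.7, Cor. 9.3, Prop. 10.2, §§16–20 (bookkeeping proved here)] -/
theorem c149_regraded :
    ((top₁₄₉).MRHThm71 ∧ (top₁₄₉).MRHThm87 ∧ (top₁₄₉).MRHThm175 ∧ (top₁₄₉).MRHCor202 ∧ (canon₃₃ νtop μtop κtop).AtobeSiegelAMF) ∧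
      (∀ l : LeafSupport.Leaf, ¬ (LeafSupport.mkN (LeafSupport.cm l)).leaf l ∧ ¬ (canon₁₄₉ (LeafSupport.mkN (LeafSupport.cm l)) μtop κtop True (canon₄₈ (LeafSupport.mkN (LeafSupport.cm l))).MoeglinElementary).MRHThm71 ∧ ¬ (canon₁₄₉ (LeafSupport.mkN (LeafSupport.cm l)) μtop κtop True (canon₄₈ (LeafSupport.mkN (LeafSupport.cm l))).MoeglinElementary).MRHCor93 ∧ ¬ (canon₁₄₉ (LeafSupport.mkN (LeafSupport.cm l)) μtop κtop True (canon₄₈ (LeafSupport.mkN (LeafSupport.cm l))).MoeglinElementary).MRHCor202) ∧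
      (¬ (canon₁₄₉ νtop μtop κtop False (canon₄₈ νtop).MoeglinElementary).MRHThm71 ∧ ¬ (canon₁₄₉ νtop μtop κtop False (canon₄₈ νtop).MoeglinElementary).MRHCor202 ∧ (canon₁₄₉ νtop μtop κtop False (canon₄₈ νtop).MoeglinElementary).MRHThm72 ∧ (canon₁₄₉ νtop μtop κtop False (canon₄₈ νtop).MoeglinElementary).MRHCor93) ∧
      (¬ (canon₁₄₉ νtop μtop κtop True (canon₄₈noR νtop).MoeglinElementary).MRHThm71 ∧ ¬ (canon₁₄₉ νtop μtop κtop True (canon₄₈noR νtop).MoeglinElementary).MRHThm51 ∧ (canon₁₄₉ νtop μtop κtop True (canon₄₈noR νtop).MoeglinElementary).MRHCor93 ∧ (canon₁₄₉ νtop μtop κtop True (canon₄₈noR νtop).MoeglinElementary).MRHProp102) :=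
  have top := hundredfortyninth_holds_top
  ⟨⟨top.1.2.2.1, top.1.2.2.2.2.2.1, top.1.2.2.2.2.2.2.2.2.2.2.1, top.1.2.2.2.2.2.2.2.2.2.2.2.2.2.2, top.2⟩,
    fun l => have h := c149_book_cm l
      ⟨h.1, h.2.2.2.1.2.1, h.2.2.1.1, h.2.2.2.1.2.2.2.2.2.2.2⟩,
    ⟨c149_b128_denied.2.2.1, c149_b128_denied.2.2.2.2.2.2.2, c149_b128_denied.2.1.2.2.1, c149_b128_denied.2.1.2.2.2.2.1⟩,
    ⟨c149_series_denied.2.2.2.2.2.2.2.2.2.1, c149_series_denied.2.2.2.2.1, c149_series_denied.2.1.1, c149_series_denied.2.1.2.2⟩⟩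

/-! ## 152. Hundred-and-fiftieth tranche (v4 of this file, after `Downstream42.lean` v2; unit `pub-arthur-down-g66`): supports of row B131 C. Mœglin, Manuscripta Math. 127 (2008) 411–467
(`MNCHyp` = the node, the 2008 standing input as printed; `MNCHypQS` ⇐ the book, ⇐ node; `MNCThm13` = §1.3 Théorème ⇐ node; `MNCThm13Sp` ⇐ `MNCHypQS`, ⇐ `MNCThm13`) and of row B130's
Corollaire 20.2 under the re-issue `E_MRHCor202M` — a reading parametrised by the node's remainder `q` (the node := book ∧ `q`, the pattern of section 47's `canon₄₅`), read against section 151's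
`canon₁₄₉ ν μ κ p r` (r := c₄₈.MoeglinElementary, arbitrary `Consumers48`) and section 149's `canon₁₄₇ ν p`. -/

section Canon150

variable (ν : Nodes) (μ : Mok2015.Nodes) (κ : KMSW2014.Nodes) (p q : Prop)

/-- The parametrised canonical reading of the hundred-and-fiftieth tranche: the node and the §1.3 theorem := the book at every rank ∧ `q`; their quasi-split Sp / SO(2n+1) instances := the book.
[cite: Moeglin2008NonCuspidal, §1.3 Théorème (canonical model; bookkeeping)] -/
abbrev canon₁₅₀ : Consumers150 where
  MNCHyp := (∀ N, ν.Everything N) ∧ q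
  MNCHypQS := ∀ N, ν.Everything N
  MNCThm13 := (∀ N, ν.Everything N) ∧ q
  MNCThm13Sp := ∀ N, ν.Everything N

variable (c₄₈ : Consumers48)

/-- All six hundred-and-fiftieth-tranche edges hold in the canonical reading, for arbitrary ν, μ, κ, p, q and tranche-48 assignment c₄₈, read against sections 1, 2, 149, 151.
[cite: Moeglin2008NonCuspidal, §1.3 Théorème; MoeglinRenard2021HighestWeight, Cor. 20.2 (bookkeeping proved here)] -/
theorem canon_implications₁₅₀ :
    Implications150 ν (canon ν μ κ) (canon₂ ν μ κ) c₄₈ (canon₁₄₇ ν p) (canon₁₄₉ ν μ κ p c₄₈.MoeglinElementary) (canon₁₅₀ ν q) where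
  hypQS := fun b => b
  hypQS_inst := fun h => h.1
  thm13 := fun h => h
  thm13Sp := fun b => b
  thm13Sp_inst := fun h => h.1
  cor202M := fun _ _ _ h _ hp _ => ⟨h, hp⟩

end Canon150

/-- At the top (book at every rank; B131's remainder granted; B128's node granted and B70 at its top value on B130's side) all four statements of row B131 hold, and row B130's Corollaire 20.2 under the
re-issue — through the tranche's own `hundredfiftieth_of_inputs` fed by `bookInputs_top`, section 151's top values (`hundredfortyninth_holds_top`, `c149_inputs_top`).
[cite: Moeglin2008NonCuspidal, §1.3 Théorème; MoeglinRenard2021HighestWeight, Cor. 20.2 (bookkeeping proved here)] -/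
theorem hundredfiftieth_holds_top :
    ((canon₁₅₀ νtop True).MNCHyp ∧ (canon₁₅₀ νtop True).MNCHypQS ∧ (canon₁₅₀ νtop True).MNCThm13 ∧ (canon₁₅₀ νtop True).MNCThm13Sp) ∧ top₁₄₉.MRHCor202 :=
  have b : ∀ N, νtop.Everything N := bookInputs_top.everything
  hundredfiftieth_of_inputs (canon_implications₁₅₀ νtop μtop κtop True True (canon₄₈ νtop)) b ⟨b, trivial⟩ b b hundredfortyninth_holds_top.1.1 c149_inputs_top.1 trivial

/-- BOOK SIDE, EXACT SUPPORTS AS TYPED: in the book countermodel of ANY of the 24 leaves `l` (B131's remainder and B128's node granted; all six edges valid) all four statements of row B131 FAIL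
(`not_B_cm`) — the 2008 hypothesis is, for the quasi-split symplectic / odd-orthogonal groups, the book's Theorem 1.5.2, every leaf of which is load-bearing — and B130's Corollaire 20.2 fails
with them. [cite: Moeglin2008NonCuspidal, introduction with p0003:L8-11, p0001:L13-15 (bookkeeping proved here)] -/
theorem c150_book_cm (l : LeafSupport.Leaf) :
    ¬ (LeafSupport.mkN (LeafSupport.cm l)).leaf l ∧
      Implications150 (LeafSupport.mkN (LeafSupport.cm l)) (canon (LeafSupport.mkN (LeafSupport.cm l)) μtop κtop) (canon₂ (LeafSupport.mkN (LeafSupport.cm l)) μtop κtop) (canon₄₈ (LeafSupport.mkN (LeafSupport.cm l))) (canon₁₄₇ (LeafSupport.mkN (LeafSupport.cm l)) True)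
        (canon₁₄₉ (LeafSupport.mkN (LeafSupport.cm l)) μtop κtop True (canon₄₈ (LeafSupport.mkN (LeafSupport.cm l))).MoeglinElementary) (canon₁₅₀ (LeafSupport.mkN (LeafSupport.cm l)) True) ∧
      (¬ (canon₁₅₀ (LeafSupport.mkN (LeafSupport.cm l)) True).MNCHyp ∧ ¬ (canon₁₅₀ (LeafSupport.mkN (LeafSupport.cm l)) True).MNCHypQS ∧ ¬ (canon₁₅₀ (LeafSupport.mkN (LeafSupport.cm l)) True).MNCThm13 ∧ ¬ (canon₁₅₀ (LeafSupport.mkN (LeafSupport.cm l)) True).MNCThm13Sp) ∧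
      ¬ (canon₁₄₉ (LeafSupport.mkN (LeafSupport.cm l)) μtop κtop True (canon₄₈ (LeafSupport.mkN (LeafSupport.cm l))).MoeglinElementary).MRHCor202 :=
  have nb := not_B_cm l
  ⟨(LeafSupport.countermodel l).2.2.1, canon_implications₁₅₀ _ _ _ _ _ _, ⟨fun h => nb h.1, nb, fun h => nb h.1, nb⟩, fun h => nb h.1.1⟩

/-- B131's NODE IS LOAD-BEARING FOR THE STATEMENT AS PRINTED, NOT FOR ITS QUASI-SPLIT Sp / SO(2n+1) CASE NOR FOR ROW B130: with the remainder `q` DENIED (book at the top; all six edges valid) the node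
and the §1.3 theorem as printed (unitary and non-quasi-split families included) FAIL while their quasi-split symplectic / odd-orthogonal instances HOLD, and B130's Corollaire 20.2 HOLDS — the binder
`MNCThm13Sp` is book-fed. [cite: Moeglin2008NonCuspidal, p0001:L15-20, L31-34; MoeglinRenard2021HighestWeight, Lemma 20.1 (bookkeeping proved here)] -/
theorem c150_node_denied :
    Implications150 νtop (canon νtop μtop κtop) (canon₂ νtop μtop κtop) (canon₄₈ νtop) (canon₁₄₇ νtop True) top₁₄₉ (canon₁₅₀ νtop False) ∧
      (¬ (canon₁₅₀ νtop False).MNCHyp ∧ ¬ (canon₁₅₀ νtop False).MNCThm13) ∧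
      ((canon₁₅₀ νtop False).MNCHypQS ∧ (canon₁₅₀ νtop False).MNCThm13Sp ∧ top₁₄₉.MRHCor202) :=
  have b : ∀ N, νtop.Everything N := bookInputs_top.everything
  ⟨canon_implications₁₅₀ _ _ _ _ _ _, ⟨fun h => h.2, fun h => h.2⟩, ⟨b, b, hundredfiftieth_holds_top.2⟩⟩

/-- ROW B130's COROLLAIRE 20.2 UNDER THE RE-ISSUE: the re-issued edge holds in section 151's reading for every value of B128's node `p`, of B131's remainder `q` and of B70 (any `Consumers48`); the
support of Corollaire 20.2 is UNCHANGED — at the top it holds, with B128's node denied it fails (section 151's `c149_b128_denied`), in the book countermodel of any leaf it fails; B131 adds no leaf to it.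
[cite: MoeglinRenard2021HighestWeight, Cor. 20.2, Lemma 20.1; Moeglin2008NonCuspidal, §1.3 Théorème (bookkeeping proved here)] -/
theorem c150_cor202_reissue (l : LeafSupport.Leaf) (p q : Prop) (c₄₈ : Consumers48) :
    E_MRHCor202M νtop (canon νtop μtop κtop) (canon₂ νtop μtop κtop) c₄₈ (canon₁₄₇ νtop p) (canon₁₄₉ νtop μtop κtop p c₄₈.MoeglinElementary) (canon₁₅₀ νtop q) ∧
      top₁₄₉.MRHCor202 ∧ ¬ (canon₁₄₉ νtop μtop κtop False (canon₄₈ νtop).MoeglinElementary).MRHCor202 ∧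
      ¬ (canon₁₄₉ (LeafSupport.mkN (LeafSupport.cm l)) μtop κtop True (canon₄₈ (LeafSupport.mkN (LeafSupport.cm l))).MoeglinElementary).MRHCor202 :=
  ⟨(canon_implications₁₅₀ νtop μtop κtop p q c₄₈).cor202M, hundredfiftieth_holds_top.2, c149_b128_denied.2.2.2.2.2.2.2, fun h => not_B_cm l h.1.1⟩

/-- THE HUNDRED-AND-FIFTIETH TRANCHE REGRADED, in one statement: (i) at the top all four statements of B131 hold and B130's Corollaire 20.2; (ii) in the book countermodel of ANY of the 24 leaves all
four FAIL; (iii) with B131's remainder denied the statement as printed FAILS and its quasi-split Sp / SO(2n+1) case HOLDS, as does B130's Corollaire 20.2.  Supports: support(`MNCHypQS`) =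
support(`MNCThm13Sp`) = the 24 book leaves; support(`MNCHyp`) = support(`MNCThm13`) = the 24 leaves ∧ the remainder (the unitary and non-quasi-split families of the 2008 hypothesis, fed by no
typed edge); support(B130's `MRHCor202`) unchanged by the re-issue.  In 2026 terms: C. Mœglin's 2008 realisation of the non-cuspidal square-integrable spectrum in residues of Eisenstein series
— « conditionnels tant que les articles d'Arthur ne sont pas publiés » — is, for quasi-split Sp(2n) / SO(2n+1), conditional on exactly the book's open residue (the 2024–2026 preprint layer and
the two unwritten weighted fundamental lemmas); row B130 used it there. [cite: Moeglin2008NonCuspidal, §1.3 Théorème with p0001:L13-15; MoeglinRenard2021HighestWeight, Cor. 20.2 (bookkeeping proved here)] -/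
theorem c150_regraded :
    (((canon₁₅₀ νtop True).MNCHyp ∧ (canon₁₅₀ νtop True).MNCThm13 ∧ (canon₁₅₀ νtop True).MNCThm13Sp) ∧ top₁₄₉.MRHCor202) ∧
      (∀ l : LeafSupport.Leaf, ¬ (LeafSupport.mkN (LeafSupport.cm l)).leaf l ∧ ¬ (canon₁₅₀ (LeafSupport.mkN (LeafSupport.cm l)) True).MNCThm13 ∧ ¬ (canon₁₅₀ (LeafSupport.mkN (LeafSupport.cm l)) True).MNCThm13Sp) ∧
      (¬ (canon₁₅₀ νtop False).MNCThm13 ∧ (canon₁₅₀ νtop False).MNCThm13Sp ∧ top₁₄₉.MRHCor202) :=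
  have top := hundredfiftieth_holds_top
  ⟨⟨⟨top.1.1, top.1.2.2.1, top.1.2.2.2⟩, top.2⟩,
    fun l => have h := c150_book_cm l
      ⟨h.1, h.2.2.1.2.2.1, h.2.2.1.2.2.2⟩,
    ⟨c150_node_denied.2.1.2, c150_node_denied.2.2.2.1, c150_node_denied.2.2.2.2⟩⟩

/-! ## 153. Hundred-and-fifty-first tranche (v5 of this file, after `Downstream43.lean` v1; unit `pub-arthur-down-g66`): supports of row A8's further statements (C. Mœglin – D. Renard, JEMS 22
(2020) = arXiv:1703.07226): `MR3Prop32` (⇐ A8-p ∧ `MR3S42` ∧ `MR3Thm93`), `MR3S42` (§4.2 ⇐ row B24), `MR3Thm47` (⇐ book ∧ B128's Cor. 4.2.2 ∧ A8-p), `MR3Thm48` (⇐ B68), `MR3Thm93` (⇐ A8 ∧ B68),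
`MR3Rem94` (⇐ A8 ∧ `MR3Thm47`), and of row A8 under the re-issue `E_MoeglinRenardM` — read against sections 1 / 2 / 13 / 53 (`canon`, `canon₂`, `canon₁₃`, `canon₅₃`) and section 149's
`canon₁₄₇ ν p` (p = B128's node).  Row A8 keeps section 2's book value (the landed edge `E_MoeglinRenard`, book ∧ B1, is the stronger one; the re-issue holds in that reading). -/

section Canon151

variable (ν : Nodes) (μ : Mok2015.Nodes) (κ : KMSW2014.Nodes) (p : Prop)

/-- The parametrised canonical reading of the hundred-and-fifty-first tranche: each statement := the conjunction of the canonical values of its typed premises (B128's statements through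
section 149's `canon₁₄₇ ν p`). [cite: MoeglinRenard2020, Prop. 3.2, §4.2, Thms 4.7, 4.8, 9.3, Rem. 9.4 (canonical model; bookkeeping)] [claim: KalethaMinguezShinWhite2014, under-review] -/
abbrev canon₁₅₁ : Consumers151 where
  MR3Prop32 := (canon₁₃ ν κ).MRpadicOrth ∧ (canon₅₃ ν μ κ).MRunitaryReal ∧ ((canon₂ ν μ κ).MoeglinRenard ∧ (canon₅₃ ν μ κ).MRtranslation)
  MR3S42 := (canon₅₃ ν μ κ).MRunitaryReal
  MR3Thm47 := (∀ N, ν.Everything N) ∧ (canon₁₄₇ ν p).MHCor422 ∧ (canon₁₃ ν κ).MRpadicOrth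
  MR3Thm48 := (canon₅₃ ν μ κ).MRtranslation
  MR3Thm93 := (canon₂ ν μ κ).MoeglinRenard ∧ (canon₅₃ ν μ κ).MRtranslation
  MR3Rem94 := (canon₂ ν μ κ).MoeglinRenard ∧ ((∀ N, ν.Everything N) ∧ (canon₁₄₇ ν p).MHCor422 ∧ (canon₁₃ ν κ).MRpadicOrth)

/-- All seven hundred-and-fifty-first-tranche edges hold in the canonical reading, for arbitrary ν, μ, κ, p. [cite: MoeglinRenard2020, Prop. 3.2, §4.2, Thms 4.7, 4.8, 9.3, Rem. 9.4 (bookkeeping proved here)] -/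
theorem canon_implications₁₅₁ :
    Implications151 ν (canon ν μ κ) (canon₂ ν μ κ) (canon₁₃ ν κ) (canon₅₃ ν μ κ) (canon₁₄₇ ν p) (canon₁₅₁ ν μ κ p) where
  s42 := fun u => u
  thm47 := fun b h o => ⟨b, h, o⟩
  thm48 := fun t => t
  mrM := fun b _ _ => b
  thm93 := fun a t => ⟨a, t⟩
  rem94 := fun a h => ⟨a, h⟩
  prop32 := fun o s h => ⟨o, s, h⟩

end Canon151

/-- At the top (book, Mok and KMSW at their top values — KMSW's two unwritten sequels granted —, B128's node granted) all six statements of the tranche hold and row A8 — through the tranche's own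
`mr3_of_rows` fed by `bookInputs_top`, section 13's `thirteenth_holds_top`, section 53's `fiftythird_holds_top`. [cite: MoeglinRenard2020, Thm 9.3 (bookkeeping proved here)] -/
theorem hundredfiftyfirst_holds_top :
    (canon₁₅₁ νtop μtop κtop True).MR3Prop32 ∧ (canon₁₅₁ νtop μtop κtop True).MR3S42 ∧ (canon₁₅₁ νtop μtop κtop True).MR3Thm47 ∧ (canon₁₅₁ νtop μtop κtop True).MR3Thm48 ∧
      (canon₁₅₁ νtop μtop κtop True).MR3Thm93 ∧ (canon₁₅₁ νtop μtop κtop True).MR3Rem94 ∧ (canon₂ νtop μtop κtop).MoeglinRenard :=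
  have b : ∀ N, νtop.Everything N := bookInputs_top.everything
  mr3_of_rows (canon_implications₁₅₁ νtop μtop κtop True) b b thirteenth_holds_top.1.2 ⟨b, trivial⟩ fiftythird_holds_top.1 fiftythird_holds_top.2.1

/-- BOOK SIDE, EXACT SUPPORTS AS TYPED: in the book countermodel of ANY of the 24 leaves `l` (Mok, KMSW at the top; B128's node granted; all seven edges valid) all six statements FAIL and row A8
fails (`not_B_cm`): every statement of [MR3] typed here rests on the book's Theorems 1.5.1 / 2.2.1 at the real place, each leaf of which is load-bearing. [cite: MoeglinRenard2020, p0009:L55-58 (bookkeeping proved here)] -/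
theorem c151_book_cm (l : LeafSupport.Leaf) :
    ¬ (LeafSupport.mkN (LeafSupport.cm l)).leaf l ∧
      Implications151 (LeafSupport.mkN (LeafSupport.cm l)) (canon (LeafSupport.mkN (LeafSupport.cm l)) μtop κtop) (canon₂ (LeafSupport.mkN (LeafSupport.cm l)) μtop κtop) (canon₁₃ (LeafSupport.mkN (LeafSupport.cm l)) κtop) (canon₅₃ (LeafSupport.mkN (LeafSupport.cm l)) μtop κtop) (canon₁₄₇ (LeafSupport.mkN (LeafSupport.cm l)) True)
        (canon₁₅₁ (LeafSupport.mkN (LeafSupport.cm l)) μtop κtop True) ∧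
      (¬ (canon₁₅₁ (LeafSupport.mkN (LeafSupport.cm l)) μtop κtop True).MR3Prop32 ∧ ¬ (canon₁₅₁ (LeafSupport.mkN (LeafSupport.cm l)) μtop κtop True).MR3S42 ∧ ¬ (canon₁₅₁ (LeafSupport.mkN (LeafSupport.cm l)) μtop κtop True).MR3Thm47 ∧
        ¬ (canon₁₅₁ (LeafSupport.mkN (LeafSupport.cm l)) μtop κtop True).MR3Thm48 ∧ ¬ (canon₁₅₁ (LeafSupport.mkN (LeafSupport.cm l)) μtop κtop True).MR3Thm93 ∧ ¬ (canon₁₅₁ (LeafSupport.mkN (LeafSupport.cm l)) μtop κtop True).MR3Rem94) ∧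
      ¬ (canon₂ (LeafSupport.mkN (LeafSupport.cm l)) μtop κtop).MoeglinRenard :=
  have nb := not_B_cm l
  ⟨(LeafSupport.countermodel l).2.2.1, canon_implications₁₅₁ _ _ _ _,
    ⟨fun h => nb h.1.1, fun h => nb h.2.2.2.1.1, fun h => nb h.1, fun h => nb h.1, fun h => nb h.1, fun h => nb h.1⟩, nb⟩

/-- B128's NODE IS LOAD-BEARING FOR THE TWO MULTIPLICITY-ONE STATEMENTS ONLY: with the node `p` DENIED (book, Mok, KMSW at the top; all seven edges valid) Théorème 4.7 and Remarque 9.4 FAIL while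
Proposition 3.2, §4.2, Théorème 4.8, Théorème 9.3 as printed and row A8 HOLD. [cite: MoeglinRenard2020, Thm 4.7 with p0012:L45-48, Rem. 9.4; Moeglin2017ArchUnipotentHowe, Cor. 4.2.2 (bookkeeping proved here)] -/
theorem c151_b128_denied :
    Implications151 νtop (canon νtop μtop κtop) (canon₂ νtop μtop κtop) (canon₁₃ νtop κtop) (canon₅₃ νtop μtop κtop) (canon₁₄₇ νtop False) (canon₁₅₁ νtop μtop κtop False) ∧
      (¬ (canon₁₅₁ νtop μtop κtop False).MR3Thm47 ∧ ¬ (canon₁₅₁ νtop μtop κtop False).MR3Rem94) ∧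
      ((canon₁₅₁ νtop μtop κtop False).MR3Prop32 ∧ (canon₁₅₁ νtop μtop κtop False).MR3S42 ∧ (canon₁₅₁ νtop μtop κtop False).MR3Thm48 ∧
        (canon₁₅₁ νtop μtop κtop False).MR3Thm93 ∧ (canon₂ νtop μtop κtop).MoeglinRenard) :=
  have b : ∀ N, νtop.Everything N := bookInputs_top.everything
  have o := thirteenth_holds_top.1.2
  have t := fiftythird_holds_top.1
  have u := fiftythird_holds_top.2.1
  ⟨canon_implications₁₅₁ _ _ _ _, ⟨fun h => h.2.1.2, fun h => h.2.2.1.2⟩, ⟨⟨o, u, b, t⟩, u, t, ⟨b, t⟩, b⟩⟩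

/-- MOK SIDE — §4.2 AND PROPOSITION 3.2 CARRY MOK's LEAVES (through row B24, the published proof of §4.2, which « utilise le résultat analogue pour les groupes unitaires »): book at the top, Mok's
countermodel of ANY Mok leaf `l` (KMSW reading `κnoMok`), B128's node granted, all seven edges valid: `MR3S42` and `MR3Prop32` FAIL (`not_M_cm`) while Théorèmes 4.7, 4.8, 9.3 as printed,
Remarque 9.4 and row A8 HOLD. [cite: MoeglinRenard2019Unitaires, p0003:L5-8; MoeglinRenard2020, §4.2 (bookkeeping proved here)] -/
theorem c151_mok_cm (l : Mok2015.LeafSupport.Leaf) :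
    ¬ (Mok2015.LeafSupport.mkN (Mok2015.LeafSupport.cm l)).leaf l ∧
      Implications151 νtop (canon νtop (Mok2015.LeafSupport.mkN (Mok2015.LeafSupport.cm l)) κnoMok) (canon₂ νtop (Mok2015.LeafSupport.mkN (Mok2015.LeafSupport.cm l)) κnoMok) (canon₁₃ νtop κnoMok) (canon₅₃ νtop (Mok2015.LeafSupport.mkN (Mok2015.LeafSupport.cm l)) κnoMok) (canon₁₄₇ νtop True)
        (canon₁₅₁ νtop (Mok2015.LeafSupport.mkN (Mok2015.LeafSupport.cm l)) κnoMok True) ∧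
      (¬ (canon₁₅₁ νtop (Mok2015.LeafSupport.mkN (Mok2015.LeafSupport.cm l)) κnoMok True).MR3S42 ∧ ¬ (canon₁₅₁ νtop (Mok2015.LeafSupport.mkN (Mok2015.LeafSupport.cm l)) κnoMok True).MR3Prop32) ∧
      ((canon₁₅₁ νtop (Mok2015.LeafSupport.mkN (Mok2015.LeafSupport.cm l)) κnoMok True).MR3Thm47 ∧ (canon₁₅₁ νtop (Mok2015.LeafSupport.mkN (Mok2015.LeafSupport.cm l)) κnoMok True).MR3Thm48 ∧ (canon₁₅₁ νtop (Mok2015.LeafSupport.mkN (Mok2015.LeafSupport.cm l)) κnoMok True).MR3Thm93 ∧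
        (canon₁₅₁ νtop (Mok2015.LeafSupport.mkN (Mok2015.LeafSupport.cm l)) κnoMok True).MR3Rem94 ∧ (canon₂ νtop (Mok2015.LeafSupport.mkN (Mok2015.LeafSupport.cm l)) κnoMok).MoeglinRenard) :=
  have b : ∀ N, νtop.Everything N := bookInputs_top.everything
  have o : (canon₁₃ νtop κnoMok).MRpadicOrth := thirteenth_holds_top.1.2
  have nm := not_M_cm l
  ⟨(Mok2015.LeafSupport.countermodel l).2.2.1, canon_implications₁₅₁ _ _ _ _, ⟨fun h => nm h.1, fun h => nm h.2.1.1⟩,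
    ⟨⟨b, ⟨b, trivial⟩, o⟩, ⟨b, o⟩, ⟨b, b, o⟩, ⟨b, b, ⟨b, trivial⟩, o⟩, b⟩⟩

/-- KMSW SIDE — THE SAME TWO STATEMENTS CARRY KMSW's LEAVES IN FULL (B24 takes the starred statements of KMSW in full): book and Mok at the top, KMSW's countermodel of ANY leaf `l ≠ MokMain`
(the unwritten sequels `KMS_A`, `KMS_B` and `AubertSS` included), B128's node granted, all seven edges valid: `MR3S42` and `MR3Prop32` FAIL while the other four and row A8 HOLD.
[claim: KalethaMinguezShinWhite2014, under-review] [cite: MoeglinRenard2019Unitaires, p0003:L33-34 (bookkeeping proved here)] -/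
theorem c151_kmsw_cm (l : KMSW2014.LeafSupport.Leaf) :
    Implications151 νtop (canon νtop μtop (KMSW2014.LeafSupport.mkN (KMSW2014.LeafSupport.cm l))) (canon₂ νtop μtop (KMSW2014.LeafSupport.mkN (KMSW2014.LeafSupport.cm l))) (canon₁₃ νtop (KMSW2014.LeafSupport.mkN (KMSW2014.LeafSupport.cm l))) (canon₅₃ νtop μtop (KMSW2014.LeafSupport.mkN (KMSW2014.LeafSupport.cm l))) (canon₁₄₇ νtop True)
        (canon₁₅₁ νtop μtop (KMSW2014.LeafSupport.mkN (KMSW2014.LeafSupport.cm l)) True) ∧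
      (¬ (canon₁₅₁ νtop μtop (KMSW2014.LeafSupport.mkN (KMSW2014.LeafSupport.cm l)) True).MR3S42 ∧ ¬ (canon₁₅₁ νtop μtop (KMSW2014.LeafSupport.mkN (KMSW2014.LeafSupport.cm l)) True).MR3Prop32) ∧
      ((canon₁₅₁ νtop μtop (KMSW2014.LeafSupport.mkN (KMSW2014.LeafSupport.cm l)) True).MR3Thm47 ∧ (canon₁₅₁ νtop μtop (KMSW2014.LeafSupport.mkN (KMSW2014.LeafSupport.cm l)) True).MR3Thm48 ∧ (canon₁₅₁ νtop μtop (KMSW2014.LeafSupport.mkN (KMSW2014.LeafSupport.cm l)) True).MR3Thm93 ∧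
        (canon₁₅₁ νtop μtop (KMSW2014.LeafSupport.mkN (KMSW2014.LeafSupport.cm l)) True).MR3Rem94 ∧ (canon₂ νtop μtop (KMSW2014.LeafSupport.mkN (KMSW2014.LeafSupport.cm l))).MoeglinRenard) :=
  have b : ∀ N, νtop.Everything N := bookInputs_top.everything
  have o : (canon₁₃ νtop (KMSW2014.LeafSupport.mkN (KMSW2014.LeafSupport.cm l))).MRpadicOrth := thirteenth_holds_top.1.2
  have nf : ¬ ∀ N, (KMSW2014.LeafSupport.mkN (KMSW2014.LeafSupport.cm l)).Full N := fun h => KMSW2014.LeafSupport.not_full_of_noFull ((KMSW2014.LeafSupport.countermodel l).2.2.2 0) (h 0)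
  ⟨canon_implications₁₅₁ _ _ _ _, ⟨fun h => nf h.2.1, fun h => nf h.2.1.2.1⟩,
    ⟨⟨b, ⟨b, trivial⟩, o⟩, ⟨b, o⟩, ⟨b, b, o⟩, ⟨b, b, ⟨b, trivial⟩, o⟩, b⟩⟩

/-- ROW A8 UNDER THE RE-ISSUE: the re-issued edge holds in sections 1 / 2 / 13's reading for every ν, μ, κ; row A8's support is UNCHANGED — at the top it holds, in the book countermodel of any
leaf it fails, in Mok's and KMSW's countermodels it holds (the binder A8-p, orthogonal case, is book-fed: `moeglinRenardM_iff_landed`). [cite: MoeglinRenard2020, Thm 9.3; MoeglinRenard2018, §4.2 (bookkeeping proved here)] -/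
theorem c151_a8_reissue (l : LeafSupport.Leaf) (l' : Mok2015.LeafSupport.Leaf) (ν : Nodes) (μ : Mok2015.Nodes) (κ : KMSW2014.Nodes) :
    E_MoeglinRenardM ν (canon ν μ κ) (canon₁₃ ν κ) (canon₂ ν μ κ) ∧ (canon₂ νtop μtop κtop).MoeglinRenard ∧ ¬ (canon₂ (LeafSupport.mkN (LeafSupport.cm l)) μtop κtop).MoeglinRenard ∧
      (canon₂ νtop (Mok2015.LeafSupport.mkN (Mok2015.LeafSupport.cm l')) κnoMok).MoeglinRenard :=
  ⟨(canon_implications₁₅₁ ν μ κ True).mrM, bookInputs_top.everything, not_B_cm l, bookInputs_top.everything⟩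

/-- THE HUNDRED-AND-FIFTY-FIRST TRANCHE REGRADED, in one statement: (i) at the top all six statements hold and row A8; (ii) in the book countermodel of ANY of the 24 leaves all six FAIL;
(iii) with B128's node denied exactly Théorème 4.7 and Remarque 9.4 fail; (iv) in Mok's countermodel of any Mok leaf and (v) in KMSW's countermodel of any KMSW leaf exactly §4.2 and
Proposition 3.2 fail.  Supports: support(`MR3Thm47`) = support(`MR3Rem94`) = the 24 book leaves ∧ B128's node (the admitted theta criterion behind « [pourhowe] »); support(`MR3Thm48`) =
support(`MR3Thm93`) = the 24 leaves; support(`MR3S42`) = support(`MR3Prop32`) = the 24 leaves ∧ Mok's leaves ∧ KMSW's leaves in full (through B24, the published proof of §4.2); row A8 under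
the re-issue: the 24 leaves, unchanged.  In 2026 terms: [MR3]'s multiplicity-one statements at the real place for unipotent and for regular good-parity parameters — the property « utile pour
le calcul des multiplicités globales » — are conditional on the book's open residue AND on the theta-lift criterion C. Mœglin admitted in Progr. Math. 323; its reduction to good parity and
the unitarity of π^A(ψ,G) for the pure inner forms SO(p,q) (the book's 9.4.2 at the real place) are, through their 2019 proof, conditional also on Mok's open residue and on KMSW's
unwritten sequels. [cite: MoeglinRenard2020, Prop. 3.2, §4.2, Thms 4.7, 4.8, 9.3, Rem. 9.4; MoeglinRenard2019Unitaires, §5; Moeglin2017ArchUnipotentHowe, Cor. 4.2.2 (bookkeeping proved here)]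
[claim: KalethaMinguezShinWhite2014, under-review] -/
theorem c151_regraded :
    ((canon₁₅₁ νtop μtop κtop True).MR3Prop32 ∧ (canon₁₅₁ νtop μtop κtop True).MR3S42 ∧ (canon₁₅₁ νtop μtop κtop True).MR3Thm47 ∧ (canon₁₅₁ νtop μtop κtop True).MR3Thm48 ∧
        (canon₁₅₁ νtop μtop κtop True).MR3Thm93 ∧ (canon₁₅₁ νtop μtop κtop True).MR3Rem94 ∧ (canon₂ νtop μtop κtop).MoeglinRenard) ∧
      (∀ l : LeafSupport.Leaf, ¬ (LeafSupport.mkN (LeafSupport.cm l)).leaf l ∧ ¬ (canon₁₅₁ (LeafSupport.mkN (LeafSupport.cm l)) μtop κtop True).MR3Thm47 ∧ ¬ (canon₁₅₁ (LeafSupport.mkN (LeafSupport.cm l)) μtop κtop True).MR3Thm93 ∧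
        ¬ (canon₁₅₁ (LeafSupport.mkN (LeafSupport.cm l)) μtop κtop True).MR3S42) ∧
      (¬ (canon₁₅₁ νtop μtop κtop False).MR3Thm47 ∧ ¬ (canon₁₅₁ νtop μtop κtop False).MR3Rem94 ∧ (canon₁₅₁ νtop μtop κtop False).MR3Thm93 ∧
        (canon₁₅₁ νtop μtop κtop False).MR3S42) ∧
      (∀ l : Mok2015.LeafSupport.Leaf, ¬ (Mok2015.LeafSupport.mkN (Mok2015.LeafSupport.cm l)).leaf l ∧ ¬ (canon₁₅₁ νtop (Mok2015.LeafSupport.mkN (Mok2015.LeafSupport.cm l)) κnoMok True).MR3S42 ∧ ¬ (canon₁₅₁ νtop (Mok2015.LeafSupport.mkN (Mok2015.LeafSupport.cm l)) κnoMok True).MR3Prop32 ∧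
        (canon₁₅₁ νtop (Mok2015.LeafSupport.mkN (Mok2015.LeafSupport.cm l)) κnoMok True).MR3Thm47) ∧
      (∀ l : KMSW2014.LeafSupport.Leaf, ¬ (canon₁₅₁ νtop μtop (KMSW2014.LeafSupport.mkN (KMSW2014.LeafSupport.cm l)) True).MR3S42 ∧ (canon₁₅₁ νtop μtop (KMSW2014.LeafSupport.mkN (KMSW2014.LeafSupport.cm l)) True).MR3Rem94) :=
  ⟨hundredfiftyfirst_holds_top,
    fun l => have h := c151_book_cm l
      ⟨h.1, h.2.2.1.2.2.1, h.2.2.1.2.2.2.2.1, h.2.2.1.2.1⟩,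
    ⟨c151_b128_denied.2.1.1, c151_b128_denied.2.1.2, c151_b128_denied.2.2.2.2.2.1, c151_b128_denied.2.2.2.1⟩,
    fun l => have h := c151_mok_cm l
      ⟨h.1, h.2.2.1.1, h.2.2.1.2, h.2.2.2.1⟩,
    fun l => have h := c151_kmsw_cm l
      ⟨h.2.1.1, h.2.2.2.2.2.1⟩⟩

/-! ## 154. Hundred-and-fifty-second tranche (v6 of this file, after `Downstream43.lean` v2; unit `pub-arthur-down-g66`): supports of row B131 with its node SUPPLIED — the unitary instance
`MNCHypU` ⇐ Mok ∧ KMSW-in-full, the non-quasi-split SO(2n+1) instance `MNCHypSOnq` ⇐ row A5 `IshimotoFull`, the §1.3 theorem's instances, and the node / theorem reconstituted from the three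
instances: section 152's remainder `q` is INSTANTIATED as (Mok ∧ KMSW-in-full) ∧ A5-as-stated (`canon₁₅₀S`), read against section 1's `canon ν μ κ` (A5 := the book, Ishimoto's sequel
granted) and against the companion reading `canonNoIshSeq` (Ishimoto's sequel denied). -/

section Canon152

variable (ν : Nodes) (μ : Mok2015.Nodes) (κ : KMSW2014.Nodes) (c : Consumers)

/-- Row B131's tranche-150 statements with the remainder instantiated: the node := the book ∧ ((Mok ∧ KMSW's starred statements in full) ∧ row A5 as read in `c`).
[cite: Moeglin2008NonCuspidal, §1.3 Théorème (canonical model; bookkeeping)] [claim: KalethaMinguezShinWhite2014, under-review] -/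
abbrev canon₁₅₀S : Consumers150 := canon₁₅₀ ν (((∀ N, μ.Everything N) ∧ (∀ N, κ.Full N)) ∧ c.IshimotoFull)

/-- The canonical reading of the hundred-and-fifty-second tranche: the unitary instances := Mok ∧ KMSW-in-full; the non-quasi-split SO(2n+1) instances := row A5's value in `c`.
[cite: Moeglin2008NonCuspidal, §1.3 Théorème; Mok2012, Thm 2.5.2; Ishimoto2024, Thm 1.2 (canonical model; bookkeeping)] [claim: KalethaMinguezShinWhite2014, under-review] -/
abbrev canon₁₅₂ : Consumers152 where
  MNCHypU := (∀ N, μ.Everything N) ∧ (∀ N, κ.Full N)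
  MNCHypSOnq := c.IshimotoFull
  MNCThm13U := (∀ N, μ.Everything N) ∧ (∀ N, κ.Full N)
  MNCThm13SOnq := c.IshimotoFull

/-- All ten hundred-and-fifty-second-tranche edges hold in the canonical reading, for arbitrary ν, μ, κ and ANY first-tranche assignment `c` (row A5's value is read from it).
[cite: Moeglin2008NonCuspidal, §1.3 Théorème (bookkeeping proved here)] -/
theorem canon_implications₁₅₂ : Implications152 μ κ c (canon₁₅₀S ν μ κ c) (canon₁₅₂ μ κ c) where
  hypU := fun m f => ⟨m, f⟩
  hypU_inst := fun h => h.2.1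
  hypSOnq := fun i => i
  hypSOnq_inst := fun h => h.2.2
  thm13U := fun h => h
  thm13U_inst := fun h => h.2.1
  thm13SOnq := fun h => h
  thm13SOnq_inst := fun h => h.2.2
  hyp_of := fun b u s => ⟨b, u, s⟩
  thm13_of := fun b u s => ⟨b, u, s⟩

/-- Section 152's six tranche-150 edges hold in the instantiated reading too (they hold for every remainder). [cite: Moeglin2008NonCuspidal, §1.3 Théorème (bookkeeping proved here)] -/
theorem canon_implications₁₅₀S (p : Prop) (c₄₈ : Consumers48) :
    Implications150 ν (canon ν μ κ) (canon₂ ν μ κ) c₄₈ (canon₁₄₇ ν p) (canon₁₄₉ ν μ κ p c₄₈.MoeglinElementary) (canon₁₅₀S ν μ κ c) :=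
  canon_implications₁₅₀ ν μ κ p _ c₄₈

end Canon152

/-- The companion first-tranche reading with ISHIMOTO's NON-GENERIC SEQUEL DENIED: row A5 as stated := the book ∧ False; everything else as in section 1's `canon`.  The first tranche's two A5
edges stay valid in it (`c152_ishimoto_denied`). [cite: Ishimoto2024, p0004:L64-66 (canonical model; bookkeeping)] -/
abbrev canonNoIshSeq : Consumers := { canon νtop μtop κtop with IshimotoSequel := False, IshimotoFull := (∀ N, νtop.Everything N) ∧ False }

/-- At the top (book, Mok, KMSW at their top values — KMSW's unwritten sequels granted —, Ishimoto's sequel granted as in section 1) all eight B131 statements hold — through the tranche's own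
`mnc_of_suppliers`. [cite: Moeglin2008NonCuspidal, §1.3 Théorème (bookkeeping proved here)] -/
theorem hundredfiftysecond_holds_top :
    ((canon₁₅₀S νtop μtop κtop (canon νtop μtop κtop)).MNCHyp ∧ (canon₁₅₀S νtop μtop κtop (canon νtop μtop κtop)).MNCHypQS ∧
        (canon₁₅₀S νtop μtop κtop (canon νtop μtop κtop)).MNCThm13 ∧ (canon₁₅₀S νtop μtop κtop (canon νtop μtop κtop)).MNCThm13Sp) ∧
      ((canon₁₅₂ μtop κtop (canon νtop μtop κtop)).MNCHypU ∧ (canon₁₅₂ μtop κtop (canon νtop μtop κtop)).MNCHypSOnq ∧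
        (canon₁₅₂ μtop κtop (canon νtop μtop κtop)).MNCThm13U ∧ (canon₁₅₂ μtop κtop (canon νtop μtop κtop)).MNCThm13SOnq) :=
  have b : ∀ N, νtop.Everything N := bookInputs_top.everything
  have KQ := kmswInputs_top μtop
  mnc_of_suppliers (canon_implications₁₅₂ νtop μtop κtop (canon νtop μtop κtop)) (canon_implications₁₅₀S νtop μtop κtop (canon νtop μtop κtop) True (canon₄₈ νtop)) b
    mokInputs_top.everything (KQ.1.full mokInputs_top KQ.2) b

/-- BOOK SIDE: in the book countermodel of ANY of the 24 leaves `l` (Mok, KMSW at the top; Ishimoto's sequel granted) the quasi-split and the non-quasi-split SO(2n+1) instances FAIL (the latter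
through Ishimoto's generic theorem, which rests on the book), hence the node and the theorem as printed fail, while the UNITARY instances HOLD — the unitary DAGs are typed apart from the
book's. [cite: Moeglin2008NonCuspidal, p0001:L31-34; Ishimoto2024, Thm 1.2 (bookkeeping proved here)] -/
theorem c152_book_cm (l : LeafSupport.Leaf) :
    ¬ (LeafSupport.mkN (LeafSupport.cm l)).leaf l ∧
      Implications152 μtop κtop (canon (LeafSupport.mkN (LeafSupport.cm l)) μtop κtop) (canon₁₅₀S (LeafSupport.mkN (LeafSupport.cm l)) μtop κtop (canon (LeafSupport.mkN (LeafSupport.cm l)) μtop κtop)) (canon₁₅₂ μtop κtop (canon (LeafSupport.mkN (LeafSupport.cm l)) μtop κtop)) ∧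
      (¬ (canon₁₅₀S (LeafSupport.mkN (LeafSupport.cm l)) μtop κtop (canon (LeafSupport.mkN (LeafSupport.cm l)) μtop κtop)).MNCHyp ∧ ¬ (canon₁₅₀S (LeafSupport.mkN (LeafSupport.cm l)) μtop κtop (canon (LeafSupport.mkN (LeafSupport.cm l)) μtop κtop)).MNCHypQS ∧
        ¬ (canon₁₅₀S (LeafSupport.mkN (LeafSupport.cm l)) μtop κtop (canon (LeafSupport.mkN (LeafSupport.cm l)) μtop κtop)).MNCThm13 ∧ ¬ (canon₁₅₂ μtop κtop (canon (LeafSupport.mkN (LeafSupport.cm l)) μtop κtop)).MNCHypSOnq ∧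
        ¬ (canon₁₅₂ μtop κtop (canon (LeafSupport.mkN (LeafSupport.cm l)) μtop κtop)).MNCThm13SOnq) ∧
      ((canon₁₅₂ μtop κtop (canon (LeafSupport.mkN (LeafSupport.cm l)) μtop κtop)).MNCHypU ∧ (canon₁₅₂ μtop κtop (canon (LeafSupport.mkN (LeafSupport.cm l)) μtop κtop)).MNCThm13U) :=
  have nb := not_B_cm l
  have KQ := kmswInputs_top μtop
  have u : (∀ N, μtop.Everything N) ∧ (∀ N, κtop.Full N) := ⟨mokInputs_top.everything, KQ.1.full mokInputs_top KQ.2⟩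
  ⟨(LeafSupport.countermodel l).2.2.1, canon_implications₁₅₂ _ _ _ _, ⟨fun h => nb h.1, nb, fun h => nb h.1, nb, nb⟩, ⟨u, u⟩⟩

/-- MOK SIDE: book at the top, Mok's countermodel of ANY Mok leaf (KMSW reading `κnoMok`): the UNITARY instances FAIL (`not_M_cm`) and with them the node and the theorem as printed
(reconstituted), while the quasi-split and the non-quasi-split SO(2n+1) instances HOLD. [cite: Moeglin2008NonCuspidal, p0001:L31-34; Mok2012, Thm 2.5.2 (bookkeeping proved here)] -/
theorem c152_mok_cm (l : Mok2015.LeafSupport.Leaf) :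
    ¬ (Mok2015.LeafSupport.mkN (Mok2015.LeafSupport.cm l)).leaf l ∧
      Implications152 (Mok2015.LeafSupport.mkN (Mok2015.LeafSupport.cm l)) κnoMok (canon νtop (Mok2015.LeafSupport.mkN (Mok2015.LeafSupport.cm l)) κnoMok) (canon₁₅₀S νtop (Mok2015.LeafSupport.mkN (Mok2015.LeafSupport.cm l)) κnoMok (canon νtop (Mok2015.LeafSupport.mkN (Mok2015.LeafSupport.cm l)) κnoMok))
        (canon₁₅₂ (Mok2015.LeafSupport.mkN (Mok2015.LeafSupport.cm l)) κnoMok (canon νtop (Mok2015.LeafSupport.mkN (Mok2015.LeafSupport.cm l)) κnoMok)) ∧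
      (¬ (canon₁₅₂ (Mok2015.LeafSupport.mkN (Mok2015.LeafSupport.cm l)) κnoMok (canon νtop (Mok2015.LeafSupport.mkN (Mok2015.LeafSupport.cm l)) κnoMok)).MNCHypU ∧ ¬ (canon₁₅₂ (Mok2015.LeafSupport.mkN (Mok2015.LeafSupport.cm l)) κnoMok (canon νtop (Mok2015.LeafSupport.mkN (Mok2015.LeafSupport.cm l)) κnoMok)).MNCThm13U ∧
        ¬ (canon₁₅₀S νtop (Mok2015.LeafSupport.mkN (Mok2015.LeafSupport.cm l)) κnoMok (canon νtop (Mok2015.LeafSupport.mkN (Mok2015.LeafSupport.cm l)) κnoMok)).MNCHyp ∧ ¬ (canon₁₅₀S νtop (Mok2015.LeafSupport.mkN (Mok2015.LeafSupport.cm l)) κnoMok (canon νtop (Mok2015.LeafSupport.mkN (Mok2015.LeafSupport.cm l)) κnoMok)).MNCThm13) ∧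
      ((canon₁₅₀S νtop (Mok2015.LeafSupport.mkN (Mok2015.LeafSupport.cm l)) κnoMok (canon νtop (Mok2015.LeafSupport.mkN (Mok2015.LeafSupport.cm l)) κnoMok)).MNCHypQS ∧ (canon₁₅₀S νtop (Mok2015.LeafSupport.mkN (Mok2015.LeafSupport.cm l)) κnoMok (canon νtop (Mok2015.LeafSupport.mkN (Mok2015.LeafSupport.cm l)) κnoMok)).MNCThm13Sp ∧
        (canon₁₅₂ (Mok2015.LeafSupport.mkN (Mok2015.LeafSupport.cm l)) κnoMok (canon νtop (Mok2015.LeafSupport.mkN (Mok2015.LeafSupport.cm l)) κnoMok)).MNCHypSOnq ∧ (canon₁₅₂ (Mok2015.LeafSupport.mkN (Mok2015.LeafSupport.cm l)) κnoMok (canon νtop (Mok2015.LeafSupport.mkN (Mok2015.LeafSupport.cm l)) κnoMok)).MNCThm13SOnq) :=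
  have b : ∀ N, νtop.Everything N := bookInputs_top.everything
  have nm := not_M_cm l
  ⟨(Mok2015.LeafSupport.countermodel l).2.2.1, canon_implications₁₅₂ _ _ _ _, ⟨fun h => nm h.1, fun h => nm h.1, fun h => nm h.2.1.1, fun h => nm h.2.1.1⟩, ⟨b, b, b, b⟩⟩

/-- KMSW SIDE: book and Mok at the top, KMSW's countermodel of ANY KMSW leaf `l` (the unwritten sequels `KMS_A`, `KMS_B`, `AubertSS` included — B131's unitary family is « quasi-split or not »,
all parameters): the UNITARY instances FAIL and with them the node, while the other instances HOLD. [claim: KalethaMinguezShinWhite2014, under-review] [cite: Moeglin2008NonCuspidal, p0001:L18 (bookkeeping proved here)] -/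
theorem c152_kmsw_cm (l : KMSW2014.LeafSupport.Leaf) :
    Implications152 μtop (KMSW2014.LeafSupport.mkN (KMSW2014.LeafSupport.cm l)) (canon νtop μtop (KMSW2014.LeafSupport.mkN (KMSW2014.LeafSupport.cm l))) (canon₁₅₀S νtop μtop (KMSW2014.LeafSupport.mkN (KMSW2014.LeafSupport.cm l)) (canon νtop μtop (KMSW2014.LeafSupport.mkN (KMSW2014.LeafSupport.cm l)))) (canon₁₅₂ μtop (KMSW2014.LeafSupport.mkN (KMSW2014.LeafSupport.cm l)) (canon νtop μtop (KMSW2014.LeafSupport.mkN (KMSW2014.LeafSupport.cm l)))) ∧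
      (¬ (canon₁₅₂ μtop (KMSW2014.LeafSupport.mkN (KMSW2014.LeafSupport.cm l)) (canon νtop μtop (KMSW2014.LeafSupport.mkN (KMSW2014.LeafSupport.cm l)))).MNCHypU ∧ ¬ (canon₁₅₀S νtop μtop (KMSW2014.LeafSupport.mkN (KMSW2014.LeafSupport.cm l)) (canon νtop μtop (KMSW2014.LeafSupport.mkN (KMSW2014.LeafSupport.cm l)))).MNCHyp) ∧
      ((canon₁₅₀S νtop μtop (KMSW2014.LeafSupport.mkN (KMSW2014.LeafSupport.cm l)) (canon νtop μtop (KMSW2014.LeafSupport.mkN (KMSW2014.LeafSupport.cm l)))).MNCHypQS ∧ (canon₁₅₂ μtop (KMSW2014.LeafSupport.mkN (KMSW2014.LeafSupport.cm l)) (canon νtop μtop (KMSW2014.LeafSupport.mkN (KMSW2014.LeafSupport.cm l)))).MNCHypSOnq) :=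
  have b : ∀ N, νtop.Everything N := bookInputs_top.everything
  have nf : ¬ ∀ N, (KMSW2014.LeafSupport.mkN (KMSW2014.LeafSupport.cm l)).Full N := fun h => KMSW2014.LeafSupport.not_full_of_noFull ((KMSW2014.LeafSupport.countermodel l).2.2.2 0) (h 0)
  ⟨canon_implications₁₅₂ _ _ _ _, ⟨fun h => nf h.2, fun h => nf h.2.1.2⟩, ⟨b, b⟩⟩

/-- ISHIMOTO's SEQUEL DENIED (`canonNoIshSeq`: book, Mok, KMSW at the top; row A5 as stated := book ∧ False; the first tranche's A5 edges `E_IshimotoGeneric`, `E_IshimotoFull` valid in that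
reading): the NON-QUASI-SPLIT SO(2n+1) instances FAIL and with them the node and the theorem as printed, while the quasi-split and the unitary instances HOLD — Ishimoto's unwritten
non-generic sequel is load-bearing for B131's node exactly through its odd-orthogonal non-quasi-split family. [cite: Ishimoto2024, p0004:L64-66; Moeglin2008NonCuspidal, p0002:L42 (bookkeeping proved here)] -/
theorem c152_ishimoto_denied :
    (E_IshimotoGeneric νtop canonNoIshSeq ∧ E_IshimotoFull canonNoIshSeq ∧ ¬ canonNoIshSeq.IshimotoSequel) ∧
      Implications152 μtop κtop canonNoIshSeq (canon₁₅₀S νtop μtop κtop canonNoIshSeq) (canon₁₅₂ μtop κtop canonNoIshSeq) ∧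
      (¬ (canon₁₅₂ μtop κtop canonNoIshSeq).MNCHypSOnq ∧ ¬ (canon₁₅₂ μtop κtop canonNoIshSeq).MNCThm13SOnq ∧
        ¬ (canon₁₅₀S νtop μtop κtop canonNoIshSeq).MNCHyp ∧ ¬ (canon₁₅₀S νtop μtop κtop canonNoIshSeq).MNCThm13) ∧
      ((canon₁₅₀S νtop μtop κtop canonNoIshSeq).MNCHypQS ∧ (canon₁₅₂ μtop κtop canonNoIshSeq).MNCHypU) :=
  have b : ∀ N, νtop.Everything N := bookInputs_top.everything
  have KQ := kmswInputs_top μtop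
  ⟨⟨fun h _ => h, fun _ s => s.elim, fun s => s⟩, canon_implications₁₅₂ _ _ _ _,
    ⟨fun h => h.2, fun h => h.2, fun h => h.2.2.2, fun h => h.2.2.2⟩, ⟨b, ⟨mokInputs_top.everything, KQ.1.full mokInputs_top KQ.2⟩⟩⟩

/-- THE HUNDRED-AND-FIFTY-SECOND TRANCHE REGRADED, in one statement: (i) at the top all eight B131 statements hold; (ii) in the book countermodel of ANY of the 24 leaves the node fails and the
unitary instance holds; (iii) in Mok's countermodel of any Mok leaf and (iv) in KMSW's countermodel of any KMSW leaf the unitary instance and the node fail, the quasi-split instance holds;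
(v) with Ishimoto's sequel denied the non-quasi-split SO(2n+1) instance and the node fail, the unitary instance holds.  Supports, exact: support(`MNCHypU`) = support(`MNCThm13U`) = Mok's
leaves ∧ KMSW's leaves in full; support(`MNCHypSOnq`) = support(`MNCThm13SOnq`) = the 24 book leaves ∧ Ishimoto's sequel; support(`MNCHyp`) = support(`MNCThm13`) under the
reconstitution = the 24 leaves ∧ Mok's leaves ∧ KMSW's leaves in full ∧ Ishimoto's sequel — section 152's « remainder fed by no typed edge » is now three named open residues;
`MNCHypQS`, `MNCThm13Sp` and row B130's Corollaire 20.2: unchanged.  In 2026 terms: C. Mœglin's 2008 standing input « tant que les articles d'Arthur ne sont pas publiés » is, eighteen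
years on, the book's open residue for Sp(2n) / quasi-split SO(2n+1), Mok's residue and KMSW's unwritten sequels for the unitary groups, and Ishimoto's unwritten non-generic sequel (with
the book's residue) for the other odd orthogonal groups. [cite: Moeglin2008NonCuspidal, introduction p0001:L13-15, §1.3 Théorème; Mok2012, Thm 2.5.2; Ishimoto2024, Thm 1.2 (bookkeeping proved here)]
[claim: KalethaMinguezShinWhite2014, under-review] -/
theorem c152_regraded :
    ((canon₁₅₀S νtop μtop κtop (canon νtop μtop κtop)).MNCHyp ∧ (canon₁₅₂ μtop κtop (canon νtop μtop κtop)).MNCHypU ∧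
        (canon₁₅₂ μtop κtop (canon νtop μtop κtop)).MNCHypSOnq ∧ (canon₁₅₀S νtop μtop κtop (canon νtop μtop κtop)).MNCThm13) ∧
      (∀ l : LeafSupport.Leaf, ¬ (LeafSupport.mkN (LeafSupport.cm l)).leaf l ∧ ¬ (canon₁₅₀S (LeafSupport.mkN (LeafSupport.cm l)) μtop κtop (canon (LeafSupport.mkN (LeafSupport.cm l)) μtop κtop)).MNCHyp ∧
        (canon₁₅₂ μtop κtop (canon (LeafSupport.mkN (LeafSupport.cm l)) μtop κtop)).MNCHypU) ∧
      (∀ l : Mok2015.LeafSupport.Leaf, ¬ (Mok2015.LeafSupport.mkN (Mok2015.LeafSupport.cm l)).leaf l ∧ ¬ (canon₁₅₂ (Mok2015.LeafSupport.mkN (Mok2015.LeafSupport.cm l)) κnoMok (canon νtop (Mok2015.LeafSupport.mkN (Mok2015.LeafSupport.cm l)) κnoMok)).MNCHypU ∧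
        ¬ (canon₁₅₀S νtop (Mok2015.LeafSupport.mkN (Mok2015.LeafSupport.cm l)) κnoMok (canon νtop (Mok2015.LeafSupport.mkN (Mok2015.LeafSupport.cm l)) κnoMok)).MNCHyp ∧ (canon₁₅₀S νtop (Mok2015.LeafSupport.mkN (Mok2015.LeafSupport.cm l)) κnoMok (canon νtop (Mok2015.LeafSupport.mkN (Mok2015.LeafSupport.cm l)) κnoMok)).MNCHypQS) ∧
      (∀ l : KMSW2014.LeafSupport.Leaf, ¬ (canon₁₅₂ μtop (KMSW2014.LeafSupport.mkN (KMSW2014.LeafSupport.cm l)) (canon νtop μtop (KMSW2014.LeafSupport.mkN (KMSW2014.LeafSupport.cm l)))).MNCHypU ∧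
        ¬ (canon₁₅₀S νtop μtop (KMSW2014.LeafSupport.mkN (KMSW2014.LeafSupport.cm l)) (canon νtop μtop (KMSW2014.LeafSupport.mkN (KMSW2014.LeafSupport.cm l)))).MNCHyp ∧ (canon₁₅₀S νtop μtop (KMSW2014.LeafSupport.mkN (KMSW2014.LeafSupport.cm l)) (canon νtop μtop (KMSW2014.LeafSupport.mkN (KMSW2014.LeafSupport.cm l)))).MNCHypQS) ∧
      (¬ (canon₁₅₂ μtop κtop canonNoIshSeq).MNCHypSOnq ∧ ¬ (canon₁₅₀S νtop μtop κtop canonNoIshSeq).MNCHyp ∧ (canon₁₅₂ μtop κtop canonNoIshSeq).MNCHypU) :=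
  have top := hundredfiftysecond_holds_top
  ⟨⟨top.1.1, top.2.1, top.2.2.1, top.1.2.2.1⟩,
    fun l => have h := c152_book_cm l
      ⟨h.1, h.2.2.1.1, h.2.2.2.1⟩,
    fun l => have h := c152_mok_cm l
      ⟨h.1, h.2.2.1.1, h.2.2.1.2.2.1, h.2.2.2.1⟩,
    fun l => have h := c152_kmsw_cm l
      ⟨h.2.1.1, h.2.1.2, h.2.2.1⟩,
    ⟨c152_ishimoto_denied.2.2.1.1, c152_ishimoto_denied.2.2.1.2.2.1, c152_ishimoto_denied.2.2.2.2⟩⟩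

/-! ## 155. Hundred-and-fifty-third tranche (v7 of this file, after `Downstream43.lean` v3; unit `pub-arthur-down-g67`): supports of row B75 (C. Mœglin, Clay Math. Proc. 13 (2011)) with its
node DECOMPOSED BY FAMILY — section 48's (`DownstreamSupport5.lean`) reading `canon₄₅` granted the node's remainder beyond the quasi-split instance as `True`; here the remainder is
INSTANTIATED as (row A8-p's orthogonal case, read in section 13's `canon₁₃ ν κ`) ∧ (the general-spin instance, a free `Prop` g) in `canon₄₅S`, the five new fields read canonically in
`canon₁₅₃` (the non-quasi-split orthogonal instance := A8-p-orth's value; the general-spin instance and statements := g; the rank ≤ 2 split sub-instance := row A4's value ∨ g; the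
non-quasi-split orthogonal statements := the book ∧ A8-p-orth; and, through the finer edge, `MoeglinMp` := the book ∧ A8-p-orth), read at the top with g GRANTED / DENIED and in the
24 book countermodels with g granted. -/

section Canon153

variable (ν : Nodes) (μ : Mok2015.Nodes) (κ : KMSW2014.Nodes) (c : Consumers) (g : Prop)

/-- Row B75's tranche-45 statements with the remainder instantiated: the node, `MoeglinMult1` := the book ∧ (A8-p's orthogonal case ∧ g); `MoeglinMp` := the book ∧ A8-p's orthogonal case;
the quasi-split instance / statements and E43 as in `canon₄₅`. [cite: Moeglin2011Mult1, §1 p0342:L22-29, §2 p0346:L26-29; MoeglinRenard2018, §3.1 (canonical model; bookkeeping)] -/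
abbrev canon₄₅S : Consumers45 where
  MoeglinDSHyp := (∀ N, ν.Everything N) ∧ ((canon₁₃ ν κ).MRpadicOrth ∧ g)
  MoeglinDSHypQS := (∀ N, ν.Everything N)
  MoeglinMult1 := (∀ N, ν.Everything N) ∧ ((canon₁₃ ν κ).MRpadicOrth ∧ g)
  MoeglinMult1qs := (∀ N, ν.Everything N)
  MoeglinMp := (∀ N, ν.Everything N) ∧ (canon₁₃ ν κ).MRpadicOrth
  MoeglinUnitaryDS := ν.LLC_GLN ∧ ν.FL ∧ ν.Transfer ∧ ν.InvariantTF ∧ ν.TwistedTF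

/-- Every forty-fifth-tranche edge holds in the instantiated reading (read against the unchanged `canon₁₃`, `canon₁₄`, `canon₄₃`, `canon₄₄`), for arbitrary ν, μ, κ and g.
[cite: Moeglin2011Mult1, Thms 2.3.1–2.5.1, §4, Thm 6.0.2; Moeglin2007Unitary, 5.7; Heiermann2017Hecke, Cor. 3.5; Heiermann2016Standard, Thms 3.1–3.3; AubertMoussaouiSolleveld2022Hecke, Thms B, C (bookkeeping proved here)] -/
theorem canon_implications₄₅S : Implications45 ν μ κ (canon₁₃ ν κ) (canon₁₄ ν) (canon₄₃ ν μ κ) (canon₄₄ ν μ κ) (canon₄₅S ν κ g) where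
  dsHypQS := fun b => b
  dsHypCase := fun h => h.1
  mult1 := fun h => h
  mult1qs := fun b => b
  mult1Case := fun h => h.1
  mp := fun h => ⟨h.1, h.2.1⟩
  unitaryDS := fun a b c d e => ⟨a, b, c, d, e⟩
  heiermannDecompM := fun b e _ _ => ⟨b, e⟩
  heiermannStdM := fun b m k _ _ => ⟨b, m, k⟩
  amsHeckeM := fun b m k e r _ _ => ⟨b, m, k, e, r⟩

/-- The canonical reading of the hundred-and-fifty-third tranche. [cite: Moeglin2011Mult1, §2 p0346:L26-29, §2.4, Prop. 3.1.1, Thm 6.0.2; MoeglinRenard2018, §3.1; GeeTaibi2019, Thm 22 (canonical model; bookkeeping)] -/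
abbrev canon₁₅₃ : Consumers153 where
  MoeglinDSHypOnq := (canon₁₃ ν κ).MRpadicOrth
  MoeglinDSHypGSpin := g
  MoeglinDSHypGSpin5 := c.GeeTaibi ∨ g
  MoeglinMult1Onq := (∀ N, ν.Everything N) ∧ (canon₁₃ ν κ).MRpadicOrth
  MoeglinMult1GSpin := g

/-- All twelve hundred-and-fifty-third-tranche edges hold in the canonical reading, for arbitrary ν, κ, g and ANY first-tranche assignment `c` (row A4's value is read from it).
[cite: Moeglin2011Mult1, Thms 2.3.1–2.5.1, §4, Prop. 3.1.1, Thm 6.0.2; MoeglinRenard2018, §3.1; GeeTaibi2019, Thm 22 (bookkeeping proved here)] -/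
theorem canon_implications₁₅₃ : Implications153 c (canon₁₃ ν κ) (canon₄₅S ν κ g) (canon₁₅₃ ν κ c g) where
  hypOnq := fun o => o
  hypOnq_inst := fun h => h.2.1
  hypGSpin_inst := fun h => h.2.2
  hypGSpin5 := fun t => Or.inl t
  hypGSpin5_inst := fun s => Or.inr s
  hyp_of := fun b o s => ⟨b, o, s⟩
  mult1Onq := fun b o => ⟨b, o⟩
  mult1Onq_inst := fun h => ⟨h.1, h.2.1⟩
  mult1GSpin := fun s => s
  mult1GSpin_inst := fun h => h.2.2
  mult1_of := fun b o s => ⟨b, o.2, s⟩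
  mpOrth := fun b o => ⟨b, o.2⟩

end Canon153

/-- The book countermodel reading of tranche 45 for the leaf `l` (Mok, KMSW at the top), the general-spin instance GRANTED. [cite: Moeglin2011Mult1, §1 (canonical model; bookkeeping)] -/
abbrev cm₄₅G (l : LeafSupport.Leaf) : Consumers45 := canon₄₅S (LeafSupport.mkN (LeafSupport.cm l)) κtop True

/-- The book countermodel reading of tranche 153 for the leaf `l`, the general-spin instance GRANTED. [cite: Moeglin2011Mult1, §2 (canonical model; bookkeeping)] -/
abbrev cm₁₅₃G (l : LeafSupport.Leaf) : Consumers153 := canon₁₅₃ (LeafSupport.mkN (LeafSupport.cm l)) κtop (canon (LeafSupport.mkN (LeafSupport.cm l)) μtop κtop) True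

/-- AT THE TOP WITH THE GENERAL-SPIN INSTANCE GRANTED, all ten B75 fields hold — through the tranche's own `hundredfiftythird_of_inputs`. [cite: Moeglin2011Mult1, Thms 2.3.1–2.5.1, §4, Prop. 3.1.1, Thm 6.0.2 (bookkeeping proved here)] -/
theorem hundredfiftythird_holds_top :
    ((canon₄₅S νtop κtop True).MoeglinDSHyp ∧ (canon₄₅S νtop κtop True).MoeglinDSHypQS ∧ (canon₄₅S νtop κtop True).MoeglinMult1 ∧ (canon₄₅S νtop κtop True).MoeglinMult1qs ∧
        (canon₄₅S νtop κtop True).MoeglinMp) ∧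
      ((canon₁₅₃ νtop κtop (canon νtop μtop κtop) True).MoeglinDSHypOnq ∧ (canon₁₅₃ νtop κtop (canon νtop μtop κtop) True).MoeglinDSHypGSpin ∧
        (canon₁₅₃ νtop κtop (canon νtop μtop κtop) True).MoeglinDSHypGSpin5 ∧ (canon₁₅₃ νtop κtop (canon νtop μtop κtop) True).MoeglinMult1Onq ∧
        (canon₁₅₃ νtop κtop (canon νtop μtop κtop) True).MoeglinMult1GSpin) :=
  hundredfiftythird_of_inputs (canon_implications₁₅₃ νtop κtop (canon νtop μtop κtop) True) (canon_implications₄₅S νtop μtop κtop True) (canon_implications νtop μtop κtop)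
    (canon_implications₁₃ νtop μtop κtop) bookInputs_top True.intro

/-- THE GENERAL-SPIN INSTANCE DENIED AT THE TOP (g := `False`; every atom of the three DAGs true): both implication bundles hold; the node, B75 as printed and the general-spin statements
FAIL, while the quasi-split instance and statements, the non-quasi-split orthogonal instance and statements, the METAPLECTIC statements and the rank ≤ 2 split sub-instance (through
row A4) HOLD — the general-spin instance is load-bearing for B75's node exactly, and for nothing of the symplectic / orthogonal / metaplectic families. [cite: Moeglin2011Mult1, §2 p0346:L26-29, Prop. 3.1.1, Thm 6.0.2; GeeTaibi2019, statement 5 (separating model; bookkeeping proved here)] -/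
theorem c153_gspin_denied :
    (Implications45 νtop μtop κtop (canon₁₃ νtop κtop) (canon₁₄ νtop) (canon₄₃ νtop μtop κtop) (canon₄₄ νtop μtop κtop) (canon₄₅S νtop κtop False) ∧
        Implications153 (canon νtop μtop κtop) (canon₁₃ νtop κtop) (canon₄₅S νtop κtop False) (canon₁₅₃ νtop κtop (canon νtop μtop κtop) False)) ∧
      (¬ (canon₄₅S νtop κtop False).MoeglinDSHyp ∧ ¬ (canon₄₅S νtop κtop False).MoeglinMult1 ∧ ¬ (canon₁₅₃ νtop κtop (canon νtop μtop κtop) False).MoeglinDSHypGSpin ∧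
        ¬ (canon₁₅₃ νtop κtop (canon νtop μtop κtop) False).MoeglinMult1GSpin) ∧
      ((canon₄₅S νtop κtop False).MoeglinDSHypQS ∧ (canon₁₅₃ νtop κtop (canon νtop μtop κtop) False).MoeglinDSHypOnq ∧ (canon₄₅S νtop κtop False).MoeglinMult1qs ∧
        (canon₁₅₃ νtop κtop (canon νtop μtop κtop) False).MoeglinMult1Onq ∧ (canon₄₅S νtop κtop False).MoeglinMp ∧ (canon₁₅₃ νtop κtop (canon νtop μtop κtop) False).MoeglinDSHypGSpin5) :=
  have X := canon_implications₁₅₃ νtop κtop (canon νtop μtop κtop) False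
  have h := moeglinOrthSymp_of_inputs X (canon_implications₄₅S νtop μtop κtop False) (canon_implications νtop μtop κtop) (canon_implications₁₃ νtop μtop κtop) bookInputs_top
  ⟨⟨canon_implications₄₅S νtop μtop κtop False, X⟩, ⟨fun x => x.2.2, fun x => x.2.2, fun x => x, fun x => x⟩,
    ⟨h.1.1, h.1.2, h.2.1, h.2.2.1, h.2.2.2, moeglinDSHypGSpin5_of_leaves X (canon_implications νtop μtop κtop) bookInputs_top⟩⟩

/-- BOOK SIDE: in the book countermodel of ANY of the 24 leaves `l` (Mok, KMSW at the top), EVEN WITH THE GENERAL-SPIN INSTANCE GRANTED, the non-quasi-split orthogonal instance (through row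
A8-p's orthogonal edge, which rests on the book), the non-quasi-split orthogonal statements, the metaplectic statements, the quasi-split instance and the node FAIL; the granted general-spin
instance and, through it, the rank ≤ 2 sub-instance hold. [cite: Moeglin2011Mult1, §2.4 (p0354:L34-45); MoeglinRenard2018, §3.1 (bookkeeping proved here)] -/
theorem c153_book_cm (l : LeafSupport.Leaf) :
    ¬ (LeafSupport.mkN (LeafSupport.cm l)).leaf l ∧
      (Implications45 (LeafSupport.mkN (LeafSupport.cm l)) μtop κtop (canon₁₃ (LeafSupport.mkN (LeafSupport.cm l)) κtop) (canon₁₄ (LeafSupport.mkN (LeafSupport.cm l))) (canon₄₃ (LeafSupport.mkN (LeafSupport.cm l)) μtop κtop) (canon₄₄ (LeafSupport.mkN (LeafSupport.cm l)) μtop κtop) (cm₄₅G l) ∧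
        Implications153 (canon (LeafSupport.mkN (LeafSupport.cm l)) μtop κtop) (canon₁₃ (LeafSupport.mkN (LeafSupport.cm l)) κtop) (cm₄₅G l) (cm₁₅₃G l)) ∧
      (¬ (cm₁₅₃G l).MoeglinDSHypOnq ∧ ¬ (cm₁₅₃G l).MoeglinMult1Onq ∧ ¬ (cm₄₅G l).MoeglinMp ∧ ¬ (cm₄₅G l).MoeglinDSHypQS ∧ ¬ (cm₄₅G l).MoeglinDSHyp) ∧
      ((cm₁₅₃G l).MoeglinDSHypGSpin ∧ (cm₁₅₃G l).MoeglinDSHypGSpin5) :=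
  have nb := not_B_cm l
  ⟨(LeafSupport.countermodel l).2.2.1, ⟨canon_implications₄₅S (LeafSupport.mkN (LeafSupport.cm l)) μtop κtop True, canon_implications₁₅₃ (LeafSupport.mkN (LeafSupport.cm l)) κtop (canon (LeafSupport.mkN (LeafSupport.cm l)) μtop κtop) True⟩,
    ⟨fun h => nb h.1, fun h => nb h.1, fun h => nb h.1, nb, fun h => nb h.1⟩, ⟨True.intro, Or.inr True.intro⟩⟩

/-- THE HUNDRED-AND-FIFTY-THIRD TRANCHE REGRADED, in one statement: (i) at the top with the general-spin instance granted the node, the non-quasi-split orthogonal instance and the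
metaplectic statements hold; (ii) with the general-spin instance DENIED at the top the node FAILS while the non-quasi-split orthogonal instance / statements and the metaplectic
statements HOLD; (iii) in the book countermodel of ANY of the 24 leaves, the general-spin instance granted, the non-quasi-split orthogonal instance, the metaplectic statements and the
node FAIL.  Supports, exact: support(`MoeglinDSHypOnq`) = support(`MoeglinMult1Onq`) = support(`MoeglinMp`) = the 24 book leaves (section 48's « the metaplectic statements wait on the
node » superseded); support(`MoeglinDSHyp`) = support(`MoeglinMult1`) = the 24 leaves ∧ the general-spin instance — section 48's remainder « granted as True » is now ONE named open
residue, the local endoscopic classification of the discrete series of the p-adic general spin groups (Gee – Taïbi's printed statement 5 beyond GSpin_5); `MoeglinDSHypQS`, `MoeglinMult1qs`,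
E43 and the canonical values of the re-issued consumers B10 / B47 / B28: unchanged.  In 2026 terms: fifteen years on, « nos résultats sont donc conditionnels » (2011: Arthur's text
unavailable) is, for the symplectic, orthogonal — quasi-split or not — and metaplectic groups, the book's own open residue; for the general spin groups it is a statement still printed as
open. [cite: Moeglin2011Mult1, §1 p0342:L28-29, §2 p0346:L26-29; MoeglinRenard2018, §3.1; GeeTaibi2019, statement 5, Rem. 11 (bookkeeping proved here)] -/
theorem c153_regraded :
    ((canon₄₅S νtop κtop True).MoeglinDSHyp ∧ (canon₁₅₃ νtop κtop (canon νtop μtop κtop) True).MoeglinDSHypOnq ∧ (canon₄₅S νtop κtop True).MoeglinMp) ∧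
      (¬ (canon₄₅S νtop κtop False).MoeglinDSHyp ∧ (canon₁₅₃ νtop κtop (canon νtop μtop κtop) False).MoeglinDSHypOnq ∧
        (canon₁₅₃ νtop κtop (canon νtop μtop κtop) False).MoeglinMult1Onq ∧ (canon₄₅S νtop κtop False).MoeglinMp) ∧
      (∀ l : LeafSupport.Leaf, ¬ (LeafSupport.mkN (LeafSupport.cm l)).leaf l ∧ ¬ (cm₁₅₃G l).MoeglinDSHypOnq ∧ ¬ (cm₄₅G l).MoeglinMp ∧ ¬ (cm₄₅G l).MoeglinDSHyp ∧ (cm₁₅₃G l).MoeglinDSHypGSpin) :=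
  have top := hundredfiftythird_holds_top
  have d := c153_gspin_denied
  ⟨⟨top.1.1, top.2.1, top.1.2.2.2.2⟩, ⟨d.2.1.1, d.2.2.2.1, d.2.2.2.2.2.1, d.2.2.2.2.2.2.1⟩,
    fun l =>
      have h := c153_book_cm l
      ⟨h.1, h.2.2.1.1, h.2.2.1.2.2.1, h.2.2.1.2.2.2.2, h.2.2.2.1⟩⟩

/-! ## 156. Hundred-and-fifty-fourth tranche (v8 of this file, after `Downstream43.lean` v4; unit `pub-arthur-down-g67`): supports of the Mœglin packet papers with the « Hypothèse générale »
RE-ISSUED BY FAMILY — sections 49 / 50's (`DownstreamSupport5.lean`) readings `canon₄₇` / `canon₄₈` gave every field « B75's value (book ∧ granted remainder) ∧ E43's leaves »; here, over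
section 155's `canon₄₅S ν κ g`, the « Hypothèse générale », B71, B72, B70's node and B70 read (B75's quasi-split ∧ non-quasi-split orthogonal statements) ∧ E43's leaves — free of g —
(`canon₄₇F`, `canon₄₈F`), while B73, B74's node and B74 keep the general-spin instance g (their premise is B75 as printed); read at the top with g granted / denied and in the 24 book
countermodels. -/

section Canon154

variable (ν : Nodes) (μ : Mok2015.Nodes) (κ : KMSW2014.Nodes) (c : Consumers) (g : Prop)

/-- Tranche 47 read with B75 by family: Arthur 2005 §30, E42 and its node as in `canon₄₇`; the « Hypothèse générale », B71, B72 := (the book ∧ (the book ∧ row A8-p's orthogonal case)) ∧ E43's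
five published leaves; the instance `MoeglinHypGenSOU` as in `canon₄₇`. [cite: Moeglin2009DiscretePackets, « Hypothèse générale » (p0005:L134); Moeglin2006PacketsComb, §1.4 (canonical model; bookkeeping)] -/
abbrev canon₄₇F : Consumers47 where
  ArthurClay30 := (∀ N, ν.Everything N)
  MoeglinIcuspHyp := True
  MoeglinDS2007 := ν.FL ∧ ν.Transfer ∧ (∀ N, ν.Everything N)
  MoeglinHypGen := ((∀ N, ν.Everything N) ∧ ((∀ N, ν.Everything N) ∧ (canon₁₃ ν κ).MRpadicOrth)) ∧ (ν.LLC_GLN ∧ ν.FL ∧ ν.Transfer ∧ ν.InvariantTF ∧ ν.TwistedTF)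
  MoeglinHypGenSOU := ((∀ N, ν.Everything N) ∧ True) ∧ (ν.LLC_GLN ∧ ν.FL ∧ ν.Transfer ∧ ν.InvariantTF ∧ ν.TwistedTF)
  MoeglinDiscretePackets := ((∀ N, ν.Everything N) ∧ ((∀ N, ν.Everything N) ∧ (canon₁₃ ν κ).MRpadicOrth)) ∧ (ν.LLC_GLN ∧ ν.FL ∧ ν.Transfer ∧ ν.InvariantTF ∧ ν.TwistedTF)
  MoeglinPacketsComb := ((∀ N, ν.Everything N) ∧ ((∀ N, ν.Everything N) ∧ (canon₁₃ ν κ).MRpadicOrth)) ∧ (ν.LLC_GLN ∧ ν.FL ∧ ν.Transfer ∧ ν.InvariantTF ∧ ν.TwistedTF)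

/-- Every forty-seventh-tranche edge holds in the family reading over `canon₄₅S` (the landed `E_MoeglinHypGen` included: B75 as printed still implies the value), for arbitrary ν, κ, g.
[cite: Moeglin2009DiscretePackets, p0005:L134; Moeglin2006PacketsComb, §1.4; Arthur2005IntroTraceFormula, Thm 30.1 (bookkeeping proved here)] -/
theorem canon_implications₄₇F : Implications47 ν (canon₄₅S ν κ g) (canon₄₇F ν κ) where
  clay30 := fun b => b
  dsHypQS_of_clay30 := fun b => b
  ds2007 := fun f t b _ => ⟨f, t, b⟩
  hypGenSOU := fun d u => ⟨⟨d.2.2, trivial⟩, u⟩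
  hypGenSOU_of_printed := fun h => ⟨⟨h.1.1, trivial⟩, h.2⟩
  hypGen := fun m u => ⟨⟨m.1, ⟨m.1, m.2.1⟩⟩, u⟩
  discretePackets := fun h => h
  packetsComb := fun h _ => h

/-- The one hundred-and-fifty-fourth-tranche edge holds in the family reading, for arbitrary ν, κ, c, g. [cite: Moeglin2009DiscretePackets, p0005:L134 (bookkeeping proved here)] -/
theorem canon_implications₁₅₄ : Implications154 (canon₄₅S ν κ g) (canon₄₇F ν κ) (canon₁₅₃ ν κ c g) where
  hypGenF := fun b o u => ⟨⟨b, o⟩, u⟩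

/-- Tranche 48 read with B75 by family: B70's node and B70 := the « Hypothèse générale »'s family value; B73, B74's node, B74 := that value ∧ the general-spin instance g (their edges take B75
as printed). [cite: Moeglin2006Elementary, §2.1; Moeglin2010Holomorphy, §1 (arXiv:0801.3339 p0004:L4); Moeglin2009Comparaison, « Conventions importantes » (canonical model; bookkeeping)] -/
abbrev canon₄₈F : Consumers48 where
  MoeglinElemHyp := ((∀ N, ν.Everything N) ∧ ((∀ N, ν.Everything N) ∧ (canon₁₃ ν κ).MRpadicOrth)) ∧ (ν.LLC_GLN ∧ ν.FL ∧ ν.Transfer ∧ ν.InvariantTF ∧ ν.TwistedTF)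
  MoeglinElementary := ((∀ N, ν.Everything N) ∧ ((∀ N, ν.Everything N) ∧ (canon₁₃ ν κ).MRpadicOrth)) ∧ (ν.LLC_GLN ∧ ν.FL ∧ ν.Transfer ∧ ν.InvariantTF ∧ ν.TwistedTF)
  MoeglinHolomorphy := (((∀ N, ν.Everything N) ∧ ((∀ N, ν.Everything N) ∧ (canon₁₃ ν κ).MRpadicOrth)) ∧ (ν.LLC_GLN ∧ ν.FL ∧ ν.Transfer ∧ ν.InvariantTF ∧ ν.TwistedTF)) ∧ g
  MoeglinLdsConv := (((∀ N, ν.Everything N) ∧ ((∀ N, ν.Everything N) ∧ (canon₁₃ ν κ).MRpadicOrth)) ∧ (ν.LLC_GLN ∧ ν.FL ∧ ν.Transfer ∧ ν.InvariantTF ∧ ν.TwistedTF)) ∧ g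
  MoeglinComparaison := (((∀ N, ν.Everything N) ∧ ((∀ N, ν.Everything N) ∧ (canon₁₃ ν κ).MRpadicOrth)) ∧ (ν.LLC_GLN ∧ ν.FL ∧ ν.Transfer ∧ ν.InvariantTF ∧ ν.TwistedTF)) ∧ g

/-- Every forty-eighth-tranche edge holds in the family reading, for arbitrary ν, κ, g. [cite: Moeglin2006Elementary, §2.1; Moeglin2010Holomorphy, Thm 3.2.1; Moeglin2009Comparaison, Thm 2.4 (bookkeeping proved here)] -/
theorem canon_implications₄₈F : Implications48 (canon₄₅S ν κ g) (canon₄₇F ν κ) (canon₄₈F ν κ g) where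
  elemHyp := fun h => h
  elementary := fun h => h
  holomorphy := fun n _ e _ _ => ⟨e, n.2.2⟩
  ldsConv := fun m d => ⟨d, m.2.2⟩
  comparaison := fun l _ _ _ _ _ _ => l

end Canon154

/-- The book countermodel readings of tranches 47 / 48 for the leaf `l`, with the general-spin instance GRANTED. [cite: Moeglin2009DiscretePackets, p0005:L134 (canonical model; bookkeeping)] -/
abbrev cm₄₇F (l : LeafSupport.Leaf) : Consumers47 := canon₄₇F (LeafSupport.mkN (LeafSupport.cm l)) κtop

/-- See `cm₄₇F`. [cite: Moeglin2006Elementary, §2.1 (canonical model; bookkeeping)] -/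
abbrev cm₄₈G (l : LeafSupport.Leaf) : Consumers48 := canon₄₈F (LeafSupport.mkN (LeafSupport.cm l)) κtop True

/-- AT THE TOP WITH THE GENERAL-SPIN INSTANCE DENIED (g := `False`): the four implication bundles (45 S, 153, 47 F, 48 F, 154) hold; the « Hypothèse générale », B71, B72, B70's node and B70
HOLD — through the tranche's own `moeglinPackets_of_inputs_2026` —, while B73, B74's node and B74 FAIL: the general-spin residue is load-bearing for the latter three only.
[cite: Moeglin2009DiscretePackets, §1.1; Moeglin2006PacketsComb, §1.4; Moeglin2010Holomorphy, §1 (arXiv:0801.3339 p0004:L4) (separating model; bookkeeping proved here)] -/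
theorem c154_gspin_denied :
    (Implications47 νtop (canon₄₅S νtop κtop False) (canon₄₇F νtop κtop) ∧ Implications48 (canon₄₅S νtop κtop False) (canon₄₇F νtop κtop) (canon₄₈F νtop κtop False) ∧
        Implications154 (canon₄₅S νtop κtop False) (canon₄₇F νtop κtop) (canon₁₅₃ νtop κtop (canon νtop μtop κtop) False)) ∧
      ((canon₄₇F νtop κtop).MoeglinHypGen ∧ (canon₄₇F νtop κtop).MoeglinDiscretePackets ∧ (canon₄₇F νtop κtop).MoeglinPacketsComb ∧ (canon₄₈F νtop κtop False).MoeglinElemHyp ∧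
        (canon₄₈F νtop κtop False).MoeglinElementary) ∧
      (¬ (canon₄₈F νtop κtop False).MoeglinHolomorphy ∧ ¬ (canon₄₈F νtop κtop False).MoeglinLdsConv ∧ ¬ (canon₄₈F νtop κtop False).MoeglinComparaison) :=
  ⟨⟨canon_implications₄₇F νtop κtop False, canon_implications₄₈F νtop κtop False, canon_implications₁₅₄ νtop κtop (canon νtop μtop κtop) False⟩,
    moeglinPackets_of_inputs_2026 (canon_implications₁₅₄ νtop κtop (canon νtop μtop κtop) False) (canon_implications₄₇F νtop κtop False) (canon_implications₄₈F νtop κtop False)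
      (canon_implications₄₅S νtop μtop κtop False) (canon_implications₁₅₃ νtop κtop (canon νtop μtop κtop) False) (canon_implications νtop μtop κtop) (canon_implications₁₃ νtop μtop κtop)
      bookInputs_top,
    ⟨fun h => h.2, fun h => h.2, fun h => h.2⟩⟩

/-- AT THE TOP WITH THE GENERAL-SPIN INSTANCE GRANTED all nine tranche-47 / 48 Mœglin-series values hold (B73, B74 through the tranche's `moeglinSeries_of_inputs_2026`).
[cite: Moeglin2010Holomorphy, Thm 3.2.1; Moeglin2009Comparaison, Thm 2.4 (bookkeeping proved here)] -/
theorem hundredfiftyfourth_holds_top :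
    ((canon₄₇F νtop κtop).MoeglinHypGen ∧ (canon₄₇F νtop κtop).MoeglinDiscretePackets ∧ (canon₄₇F νtop κtop).MoeglinPacketsComb ∧ (canon₄₈F νtop κtop True).MoeglinElemHyp ∧
        (canon₄₈F νtop κtop True).MoeglinElementary) ∧
      ((canon₄₅S νtop κtop True).MoeglinMult1 ∧ (canon₄₈F νtop κtop True).MoeglinHolomorphy ∧ (canon₄₈F νtop κtop True).MoeglinLdsConv ∧ (canon₄₈F νtop κtop True).MoeglinComparaison) :=
  have h := moeglinSeries_of_inputs_2026 (canon_implications₁₅₄ νtop κtop (canon νtop μtop κtop) True) (canon_implications₄₇F νtop κtop True) (canon_implications₄₈F νtop κtop True)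
    (canon_implications₄₅S νtop μtop κtop True) (canon_implications₁₅₃ νtop κtop (canon νtop μtop κtop) True) (canon_implications νtop μtop κtop) (canon_implications₁₃ νtop μtop κtop)
    bookInputs_top
  ⟨h.1.2.2, h.2 True.intro⟩

/-- BOOK SIDE: in the book countermodel of ANY of the 24 leaves `l`, the general-spin instance GRANTED, the « Hypothèse générale », B71, B72, B70 and B73 / B74 all FAIL (the book's output
fails; E43's leaves may hold). [cite: Moeglin2009DiscretePackets, p0005:L134 (bookkeeping proved here)] -/
theorem c154_book_cm (l : LeafSupport.Leaf) :
    ¬ (LeafSupport.mkN (LeafSupport.cm l)).leaf l ∧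
      (Implications47 (LeafSupport.mkN (LeafSupport.cm l)) (cm₄₅G l) (cm₄₇F l) ∧ Implications48 (cm₄₅G l) (cm₄₇F l) (cm₄₈G l) ∧ Implications154 (cm₄₅G l) (cm₄₇F l) (cm₁₅₃G l)) ∧
      (¬ (cm₄₇F l).MoeglinHypGen ∧ ¬ (cm₄₇F l).MoeglinDiscretePackets ∧ ¬ (cm₄₈G l).MoeglinElementary ∧ ¬ (cm₄₈G l).MoeglinHolomorphy ∧ ¬ (cm₄₈G l).MoeglinComparaison) :=
  have nb := not_B_cm l
  ⟨(LeafSupport.countermodel l).2.2.1, ⟨canon_implications₄₇F (LeafSupport.mkN (LeafSupport.cm l)) κtop True, canon_implications₄₈F (LeafSupport.mkN (LeafSupport.cm l)) κtop True, canon_implications₁₅₄ (LeafSupport.mkN (LeafSupport.cm l)) κtop (canon (LeafSupport.mkN (LeafSupport.cm l)) μtop κtop) True⟩,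
    ⟨fun h => nb h.1.1, fun h => nb h.1.1, fun h => nb h.1.1, fun h => nb h.1.1.1, fun h => nb h.1.1.1⟩⟩

/-- THE HUNDRED-AND-FIFTY-FOURTH TRANCHE REGRADED, in one statement: (i) at the top with the general-spin instance DENIED the « Hypothèse générale », B71, B72, B70's node, B70 HOLD and B73 /
B74's node / B74 FAIL; (ii) with it granted all hold; (iii) in the book countermodel of any of the 24 leaves (g granted) the « Hypothèse générale » and B70 fail.  Supports, exact:
support(`MoeglinHypGen`) = support(`MoeglinDiscretePackets`) = support(`MoeglinPacketsComb`) = support(`MoeglinElemHyp`) = support(`MoeglinElementary`) = THE 24 BOOK LEAVES (sections 49 /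
50's « book ∧ granted remainder » loses its remainder for these five: C. Mœglin's packet constructions of 2004–2009 for the symplectic and orthogonal p-adic groups stand, in 2026, on
[Art13]'s own open residue and nothing else); support(`MoeglinHolomorphy`) = support(`MoeglinLdsConv`) = support(`MoeglinComparaison`) = the 24 leaves ∧ the general-spin instance
(B73's scope names Gspin(2n+1), Gspin(2n); B74 runs through B73).  E42, Arthur 2005 §30, `MoeglinHypGenSOU`: unchanged. [cite: Moeglin2009DiscretePackets, « Hypothèse générale » (p0005:L134), §1.1; Moeglin2006PacketsComb, §1.4; Moeglin2006Elementary, §2.1; Moeglin2010Holomorphy, §1; Moeglin2009Comparaison, §2.1 (bookkeeping proved here)] -/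
theorem c154_regraded :
    (((canon₄₇F νtop κtop).MoeglinHypGen ∧ (canon₄₈F νtop κtop False).MoeglinElementary) ∧ (¬ (canon₄₈F νtop κtop False).MoeglinHolomorphy ∧ ¬ (canon₄₈F νtop κtop False).MoeglinComparaison)) ∧
      ((canon₄₈F νtop κtop True).MoeglinHolomorphy ∧ (canon₄₈F νtop κtop True).MoeglinComparaison) ∧
      (∀ l : LeafSupport.Leaf, ¬ (LeafSupport.mkN (LeafSupport.cm l)).leaf l ∧ ¬ (cm₄₇F l).MoeglinHypGen ∧ ¬ (cm₄₈G l).MoeglinElementary) :=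
  have d := c154_gspin_denied
  have t := hundredfiftyfourth_holds_top
  ⟨⟨⟨d.2.1.1, d.2.1.2.2.2.2⟩, ⟨d.2.2.1, d.2.2.2.2⟩⟩, ⟨t.2.2.1, t.2.2.2.2⟩,
    fun l =>
      have h := c154_book_cm l
      ⟨h.1, h.2.2.1, h.2.2.2.2.1⟩⟩

/-! ## 157. Hundred-and-fifty-fifth tranche (v9 of this file, after NEW `Downstream44.lean` v1 — register file M308, hence the added `import …Downstream44`; unit `pub-arthur-down-g67`): supports of
rows B10 / B47 (V. Heiermann) with their Mœglin binder RE-ISSUED BY FAMILY.  Section 47's (`DownstreamSupport5.lean`) canonical values of `canon₄₄` are unchanged (B10 := the book ∧ row E41's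
value; B47 := the book ∧ Mok ∧ KMSW's proved scope); what this section certifies is the ROUTE: the family edges of tranche 155 hold over section 155's `canon₄₅S ν κ g` / `canon₁₅₃ ν κ c g`
for every g, and at the top WITH THE GENERAL-SPIN INSTANCE DENIED both statements are delivered by the tranche's own `heiermannF_of_inputs_2026` while B75's node fails — section 48's
« B10 / B47 through the re-issued edge need the node » (companions `c₄₄noM`) no longer describes their support. -/

section Canon155

variable (ν : Nodes) (μ : Mok2015.Nodes) (κ : KMSW2014.Nodes) (c : Consumers) (g : Prop)

/-- Both hundred-and-fifty-fifth-tranche edges hold in the canonical readings (section 47's `canon₄₄`, section 14's `canon₁₄`, section 155's `canon₄₅S` / `canon₁₅₃`), for arbitrary ν, μ, κ, c, g.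
[cite: Heiermann2017Hecke, Cor. 3.5; Heiermann2016Standard, Thms 3.1–3.3 (bookkeeping proved here)] -/
theorem canon_implications₁₅₅ : Implications155 ν μ κ (canon₁₄ ν) (canon₄₄ ν μ κ) (canon₄₅S ν κ g) (canon₁₅₃ ν κ c g) where
  decompF := fun b e _ _ _ => ⟨b, e⟩
  stdF := fun b m k _ _ _ => ⟨b, m, k⟩

end Canon155

/-- AT THE TOP WITH THE GENERAL-SPIN INSTANCE DENIED (g := `False`): B10 and B47 HOLD — delivered by the tranche's `heiermannF_of_inputs_2026` from the canonical bundles of tranches 1, 13, 14,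
45 (instantiated), 153, 155 and the top inputs of the three DAGs —, while B75's node and B75 as printed FAIL in the same reading: the general-spin residue is NOT in the support of Heiermann's
two rows. [cite: Heiermann2017Hecke, Cor. 3.5, p0001:L48; Heiermann2016Standard, §3 (separating model; bookkeeping proved here)] [claim: KalethaMinguezShinWhite2014, under-review] -/
theorem c155_gspin_denied :
    Implications155 νtop μtop κtop (canon₁₄ νtop) (canon₄₄ νtop μtop κtop) (canon₄₅S νtop κtop False) (canon₁₅₃ νtop κtop (canon νtop μtop κtop) False) ∧
      ((canon₄₄ νtop μtop κtop).HeiermannDecomp ∧ (canon₄₄ νtop μtop κtop).HeiermannStd) ∧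
      (¬ (canon₄₅S νtop κtop False).MoeglinDSHyp ∧ ¬ (canon₄₅S νtop κtop False).MoeglinMult1) :=
  have Y := canon_implications₁₅₅ νtop μtop κtop (canon νtop μtop κtop) False
  ⟨Y, heiermannF_of_inputs_2026 Y (canon_implications₄₅S νtop μtop κtop False) (canon_implications₁₅₃ νtop κtop (canon νtop μtop κtop) False) (canon_implications νtop μtop κtop)
      (canon_implications₁₃ νtop μtop κtop) (canon_implications₁₄ νtop) bookInputs_top mokInputs_top (kmswInputs_top μtop).1,
    ⟨fun x => x.2.2, fun x => x.2.2⟩⟩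

/-- BOOK SIDE: in the book countermodel of ANY of the 24 leaves `l` (Mok, KMSW at the top; g granted) the two edges hold and B10, B47 FAIL. [cite: Heiermann2017Hecke, p0001:L50 (bookkeeping proved here)] -/
theorem c155_book_cm (l : LeafSupport.Leaf) :
    ¬ (LeafSupport.mkN (LeafSupport.cm l)).leaf l ∧ Implications155 (LeafSupport.mkN (LeafSupport.cm l)) μtop κtop (canon₁₄ (LeafSupport.mkN (LeafSupport.cm l))) (canon₄₄ (LeafSupport.mkN (LeafSupport.cm l)) μtop κtop) (cm₄₅G l) (cm₁₅₃G l) ∧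
      (¬ (canon₄₄ (LeafSupport.mkN (LeafSupport.cm l)) μtop κtop).HeiermannDecomp ∧ ¬ (canon₄₄ (LeafSupport.mkN (LeafSupport.cm l)) μtop κtop).HeiermannStd) :=
  have nb := not_B_cm l
  ⟨(LeafSupport.countermodel l).2.2.1, canon_implications₁₅₅ (LeafSupport.mkN (LeafSupport.cm l)) μtop κtop (canon (LeafSupport.mkN (LeafSupport.cm l)) μtop κtop) True, ⟨fun h => nb h.1, fun h => nb h.1⟩⟩

/-- MOK SIDE (B47 only): book at the top, Mok's countermodel of ANY Mok leaf (KMSW reading `κnoMok`): the edges hold, B10 HOLDS, B47 FAILS. [cite: Heiermann2016Standard, §3.1 p0006:L3 (bookkeeping proved here)] -/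
theorem c155_mok_cm (l : Mok2015.LeafSupport.Leaf) :
    ¬ (Mok2015.LeafSupport.mkN (Mok2015.LeafSupport.cm l)).leaf l ∧
      Implications155 νtop (Mok2015.LeafSupport.mkN (Mok2015.LeafSupport.cm l)) κnoMok (canon₁₄ νtop) (canon₄₄ νtop (Mok2015.LeafSupport.mkN (Mok2015.LeafSupport.cm l)) κnoMok) (canon₄₅S νtop κnoMok True)
        (canon₁₅₃ νtop κnoMok (canon νtop (Mok2015.LeafSupport.mkN (Mok2015.LeafSupport.cm l)) κnoMok) True) ∧
      ((canon₄₄ νtop (Mok2015.LeafSupport.mkN (Mok2015.LeafSupport.cm l)) κnoMok).HeiermannDecomp ∧ ¬ (canon₄₄ νtop (Mok2015.LeafSupport.mkN (Mok2015.LeafSupport.cm l)) κnoMok).HeiermannStd) :=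
  have nm := not_M_cm l
  ⟨(Mok2015.LeafSupport.countermodel l).2.2.1, canon_implications₁₅₅ _ _ _ _ _,
    ⟨⟨bookInputs_top.everything, (moeglinStable_of_bookInputs (canon_implications₁₄ νtop) bookInputs_top)⟩, fun h => nm h.2.1⟩⟩

/-- THE HUNDRED-AND-FIFTY-FIFTH TRANCHE REGRADED, in one statement: (i) at the top with the general-spin instance DENIED B10 and B47 hold while B75's node fails; (ii) in the book countermodel of
any of the 24 leaves both fail; (iii) in Mok's countermodel of any Mok leaf B10 holds and B47 fails.  Supports, exact, through the family edges: support(`HeiermannDecomp`) = the 24 book leaves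
(row E41's seven leaves and E43's five lie among them); support(`HeiermannStd`) = the 24 leaves ∧ Mok's leaves ∧ KMSW's proved-scope leaves (section 47, unchanged) — and NOT B75's node nor
its general-spin instance: Heiermann's 2015 proviso « some generalization of [A] to inner forms may be required for [M1, M3], but this is forthcoming » is, for his orthogonal G⁻, [MR18]
(2018), itself fed by the 24 leaves. [cite: Heiermann2017Hecke, p0002:L3, Cor. 3.5; Heiermann2016Standard, Thms 3.1–3.3; MoeglinRenard2018, §3.1 (bookkeeping proved here)] [claim: KalethaMinguezShinWhite2014, under-review] -/
theorem c155_regraded :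
    (((canon₄₄ νtop μtop κtop).HeiermannDecomp ∧ (canon₄₄ νtop μtop κtop).HeiermannStd) ∧ ¬ (canon₄₅S νtop κtop False).MoeglinDSHyp) ∧
      (∀ l : LeafSupport.Leaf, ¬ (LeafSupport.mkN (LeafSupport.cm l)).leaf l ∧ ¬ (canon₄₄ (LeafSupport.mkN (LeafSupport.cm l)) μtop κtop).HeiermannDecomp ∧ ¬ (canon₄₄ (LeafSupport.mkN (LeafSupport.cm l)) μtop κtop).HeiermannStd) ∧
      (∀ l : Mok2015.LeafSupport.Leaf, ¬ (Mok2015.LeafSupport.mkN (Mok2015.LeafSupport.cm l)).leaf l ∧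
        (canon₄₄ νtop (Mok2015.LeafSupport.mkN (Mok2015.LeafSupport.cm l)) κnoMok).HeiermannDecomp ∧ ¬ (canon₄₄ νtop (Mok2015.LeafSupport.mkN (Mok2015.LeafSupport.cm l)) κnoMok).HeiermannStd) :=
  have d := c155_gspin_denied
  ⟨⟨d.2.1, d.2.2.1⟩,
    fun l =>
      have h := c155_book_cm l
      ⟨h.1, h.2.2.1, h.2.2.2⟩,
    fun l =>
      have h := c155_mok_cm l
      ⟨h.1, h.2.2.1, h.2.2.2⟩⟩

/-! ## 158. Hundred-and-fifty-sixth tranche (v10 of this file; unit `pub-arthur-down-g67`): supports of rows B108 (M. Tadić, Mem. AMS 286 (2023)), B103 (G. K.-F. Tam, J. Algebra 663 (2025))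
and A11 (R. Chen – J. Zou, arXiv:2104.12354) with their Mœglin binder RE-ISSUED BY FAMILY (tranche 156, `Downstream44.lean` v2).  Section 52's (`DownstreamSupport6.lean`) value of B108
(`canon₅₂`: « the book proves everything at every rank ») is unchanged; rows B103 and A11 get FAMILY READINGS `canon₁₃₁F` / `canon₅₆F` — section 131's `canon₁₃₁W` (`DownstreamSupport16.lean`)
and section 56's `canon₅₆` (`DownstreamSupport7.lean`) with B75's slot := (B75 quasi-split ∧ B75 non-quasi-split orthogonal) = (the book ∧ (the book ∧ [MR18]'s orthogonal value
`(canon₁₃ ν κ).MRpadicOrth`)), general-spin-free — in which the LANDED edges of tranches 131 / 56 still hold over section 155's `canon₄₅S ν κ g` for every g (`canon_implications₁₃₁F`,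
`canon_implications₅₆F`; tranche 52's over `canon₄₅S`: `canon_implications₅₂S`).  What this section certifies is the ROUTE: the four family edges hold over `canon₄₅S ν κ g` /
`canon₁₅₃ ν κ c g` for every g (`canon_implications₁₅₆`), and at the top WITH THE GENERAL-SPIN INSTANCE DENIED all four statements are delivered by the tranche's own
`tadicCorank3F_of_inputs` / `tamF_of_inputs` / `chenZouThetaPacketsF_of_inputs` while B75's node fails — the « ∧ B75's node » of sections 56 / 131 (separating readings `canon₅₆noR`,
`canon₁₃₁noR`) no longer describes the supports of A11 / B103, and B108's binder no longer carries the general-spin residue.  Mok and KMSW sides are untouched by the re-issue (only B75's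
slot changes): Tam's packets keep Mok's leaves and KMSW's proved scope (section 131's `c131_mok_cm`, `c131_kmsw`), A11 keeps Mok's leaves (section 56). -/

section Canon156

variable (ν : Nodes) (μ : Mok2015.Nodes) (κ : KMSW2014.Nodes) (c : Consumers) (g : Prop)

/-- The FAMILY reading of row B103 (tranche 131's two Tam fields; C117's and C130's nodes and statements granted, as in section 131's `canon₁₃₁`): Tam's count := (B75 quasi-split ∧ B75
non-quasi-split orthogonal) ∧ E43's value; Tam's packets := the conjunction of the family edge's premises (the count by its value). [cite: Tam2025DepthZero, (2.19), Thm 1.1; Moeglin2011Mult1, Thm 2.5.1; MoeglinRenard2018, §3.1 (canonical model; bookkeeping)] [claim: KalethaMinguezShinWhite2014, under-review] -/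
abbrev canon₁₃₁F : Consumers131 where
  TamCount := ((∀ N, ν.Everything N) ∧ ((∀ N, ν.Everything N) ∧ (canon₁₃ ν κ).MRpadicOrth)) ∧ (ν.LLC_GLN ∧ ν.FL ∧ ν.Transfer ∧ ν.InvariantTF ∧ ν.TwistedTF)
  TamTASpackets := (∀ N, ν.Everything N) ∧ (∀ N, μ.Everything N) ∧ (∀ N, κ.Scope N) ∧ (canon₁₄ ν).MoeglinStable ∧ (ν.LLC_GLN ∧ ν.FL ∧ ν.Transfer ∧ ν.InvariantTF ∧ ν.TwistedTF) ∧ ((∀ N, ν.Everything N) ∧ ((∀ N, ν.Everything N) ∧ (canon₁₃ ν κ).MRpadicOrth)) ∧ (canon₁₃ ν κ).MRpadic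
  HTXmultEq := True
  HTXtate := True
  KakLLC := True
  KakLifting := True
  KakNonarch := True ∧ True

/-- The LANDED edges of tranche 131 hold in the family reading over section 155's `canon₄₅S ν κ g`, for arbitrary ν, μ, κ, g (B75 as printed there := quasi-split ∧ orthogonal ∧ g, which
implies the family value). [cite: Tam2025DepthZero, (2.19), Thm 1.1 (bookkeeping proved here)] [claim: KalethaMinguezShinWhite2014, under-review] -/
theorem canon_implications₁₃₁F : Implications131 ν μ κ (canon₁₃ ν κ) (canon₁₄ ν) (canon₄₅S ν κ g) (canon₁₃₁F ν μ κ) where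
  tamCount := fun m u => ⟨⟨m.1, ⟨m.1, m.2.1⟩⟩, u⟩
  tamPackets := fun b mo k s u m r _ => ⟨b, mo, k, s, u, ⟨m.1, ⟨m.1, m.2.1⟩⟩, r⟩
  htx := fun h => h
  kak := fun a l => ⟨a, l⟩

/-- The FAMILY reading of row A11 (tranche 56; A9 := the book, B12's node and B12 granted, as in section 56's `canon₅₆`): A11 := (the book ∧ Mok — A6's value in `canon`) ∧ (B75 quasi-split ∧
B75 non-quasi-split orthogonal). [cite: ChenZou2021ThetaPackets, Thm 2.8; Moeglin2011Mult1, Thm 2.5.1; MoeglinRenard2018, §3.1 (canonical model; bookkeeping)] -/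
abbrev canon₅₆F : Consumers56 where
  ChenZouLLCO := (∀ N, ν.Everything N)
  ChenZouThetaPackets := ((∀ N, ν.Everything N) ∧ (∀ N, μ.Everything N)) ∧ ((∀ N, ν.Everything N) ∧ ((∀ N, ν.Everything N) ∧ (canon₁₃ ν κ).MRpadicOrth))
  AtobeFJHyp := True
  AtobeFJ := True

/-- The LANDED edges of tranche 56 hold in the family reading over `canon` (tranche 1), `canon₂`, section 155's `canon₄₅S ν κ g`, for arbitrary ν, μ, κ, g. [cite: ChenZou2021ThetaPackets, Thm 2.8 (bookkeeping proved here)] -/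
theorem canon_implications₅₆F : Implications56 ν μ (canon ν μ κ) (canon₂ ν μ κ) (canon₄₅S ν κ g) (canon₅₆F ν μ κ) where
  llcO := fun b => b
  thetaPackets := fun _ _ cz m _ => ⟨cz, ⟨m.1, ⟨m.1, m.2.1⟩⟩⟩
  atobeFJ := fun h => h

/-- The LANDED edges of tranche 52 hold over section 155's `canon₄₅S ν κ g` with section 52's `canon₅₂` (B108 := the book) and sections 13 / 14 / 50 / 51 canonical, for arbitrary ν, κ, g —
section 52's `canon_implications₅₂` field for field, B108's edge re-read. [cite: Tadic2023Corank3, §6 (bookkeeping proved here)] -/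
theorem canon_implications₅₂S : Implications52 ν (canon₁₃ ν κ) (canon₁₄ ν) (canon₄₅S ν κ g) (canon₅₀ ν) (canon₅₁ ν) (canon₅₂ ν) where
  halfIntNonQS := (canon_implications₅₂ ν κ).halfIntNonQS
  ltMain := (canon_implications₅₂ ν κ).ltMain
  tadic18 := (canon_implications₅₂ ν κ).tadic18
  tadic23 := fun b _ => b
  brajkovic := (canon_implications₅₂ ν κ).brajkovic
  ciganovic := (canon_implications₅₂ ν κ).ciganovic
  bosnjak := (canon_implications₅₂ ν κ).bosnjak
  klm := (canon_implications₅₂ ν κ).klm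
  kimMatic := (canon_implications₅₂ ν κ).kimMatic

/-- All four hundred-and-fifty-sixth-tranche edges hold in the canonical readings (`canon`, `canon₂`, `canon₁₃`, `canon₁₄`, section 155's `canon₄₅S` / `canon₁₅₃`, section 52's `canon₅₂`, the
family readings `canon₅₆F` / `canon₁₃₁F`), for arbitrary ν, μ, κ, c, g. [cite: Tadic2023Corank3, §6; Tam2025DepthZero, (2.19), Thm 1.1; ChenZou2021ThetaPackets, Thm 2.8 (bookkeeping proved here)] [claim: KalethaMinguezShinWhite2014, under-review] -/
theorem canon_implications₁₅₆ :
    Implications156 ν μ κ (canon ν μ κ) (canon₂ ν μ κ) (canon₁₃ ν κ) (canon₁₄ ν) (canon₄₅S ν κ g) (canon₅₂ ν) (canon₅₆F ν μ κ) (canon₁₃₁F ν μ κ) (canon₁₅₃ ν κ c g) where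
  tadicF := fun b _ _ => b
  tamCountF := fun b o u => ⟨⟨b, o⟩, u⟩
  tamPacketsF := fun b mo k s u qs o r _ => ⟨b, mo, k, s, u, ⟨qs, o⟩, r⟩
  chenZouF := fun _ _ cz qs o _ => ⟨cz, ⟨qs, o⟩⟩

end Canon156

/-- Book-countermodel instances of the family readings (Mok, KMSW at the top). [cite: Tam2025DepthZero, Thm 1.1; ChenZou2021ThetaPackets, Thm 2.8 (separating models; bookkeeping)] [claim: KalethaMinguezShinWhite2014, under-review] -/
abbrev cm₁₃₁F (l : LeafSupport.Leaf) : Consumers131 := canon₁₃₁F (LeafSupport.mkN (LeafSupport.cm l)) μtop κtop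

/-- See `cm₁₃₁F`. [cite: ChenZou2021ThetaPackets, Thm 2.8 (separating models; bookkeeping)] -/
abbrev cm₅₆F (l : LeafSupport.Leaf) : Consumers56 := canon₅₆F (LeafSupport.mkN (LeafSupport.cm l)) μtop κtop

/-- AT THE TOP WITH THE GENERAL-SPIN INSTANCE DENIED (g := `False`): B108, Tam's count and Tam's packets (B103), A11 HOLD — delivered by the tranche's `tadicCorank3F_of_inputs`,
`tamF_of_inputs`, `chenZouThetaPacketsF_of_inputs` from the canonical bundles of tranches 1, 13, 14, 45 (instantiated), 153, 156, the top inputs of the three DAGs and B6's printed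
parametrisation at its canonical value (the book) —, while B75's node and B75 as printed FAIL in the same reading: the general-spin residue is NOT in the support of the three rows.
[cite: Tadic2023Corank3, §6, §3 (arXiv:2006.12609 p0010:L6-13); Tam2025DepthZero, Thm 1.1, §2.2 (p0008:L11-12); ChenZou2021ThetaPackets, Thm 2.8, §1 (p0003:L19) (separating model; bookkeeping proved here)] [claim: KalethaMinguezShinWhite2014, under-review] -/
theorem c156_gspin_denied :
    Implications156 νtop μtop κtop (canon νtop μtop κtop) (canon₂ νtop μtop κtop) (canon₁₃ νtop κtop) (canon₁₄ νtop) (canon₄₅S νtop κtop False) (canon₅₂ νtop) (canon₅₆F νtop μtop κtop)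
        (canon₁₃₁F νtop μtop κtop) (canon₁₅₃ νtop κtop (canon νtop μtop κtop) False) ∧
      ((canon₅₂ νtop).TadicCorank3 ∧ ((canon₁₃₁F νtop μtop κtop).TamCount ∧ (canon₁₃₁F νtop μtop κtop).TamTASpackets) ∧ (canon₅₆F νtop μtop κtop).ChenZouThetaPackets) ∧
      (¬ (canon₄₅S νtop κtop False).MoeglinDSHyp ∧ ¬ (canon₄₅S νtop κtop False).MoeglinMult1) :=
  have Y := canon_implications₁₅₆ νtop μtop κtop (canon νtop μtop κtop) False
  have V := canon_implications₄₅S νtop μtop κtop False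
  have X := canon_implications₁₅₃ νtop κtop (canon νtop μtop κtop) False
  have I := canon_implications νtop μtop κtop
  have G := canon_implications₁₃ νtop μtop κtop
  ⟨Y, ⟨tadicCorank3F_of_inputs Y V X I G bookInputs_top, tamF_of_inputs Y V X I G (canon_implications₁₄ νtop) bookInputs_top mokInputs_top (kmswInputs_top μtop).1,
      chenZouThetaPacketsF_of_inputs Y V X I G bookInputs_top mokInputs_top bookInputs_top.everything⟩,
    ⟨fun x => x.2.2, fun x => x.2.2⟩⟩

/-- BOOK SIDE: in the book countermodel of ANY of the 24 leaves `l` (Mok, KMSW at the top; g granted) the four edges hold and B108, Tam's count, Tam's packets, A11 all FAIL. [cite: Tadic2023Corank3, §6; Tam2025DepthZero, Thm 1.1; ChenZou2021ThetaPackets, Thm 2.8 (bookkeeping proved here)] [claim: KalethaMinguezShinWhite2014, under-review] -/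
theorem c156_book_cm (l : LeafSupport.Leaf) :
    ¬ (LeafSupport.mkN (LeafSupport.cm l)).leaf l ∧
      Implications156 (LeafSupport.mkN (LeafSupport.cm l)) μtop κtop (canon (LeafSupport.mkN (LeafSupport.cm l)) μtop κtop) (canon₂ (LeafSupport.mkN (LeafSupport.cm l)) μtop κtop) (canon₁₃ (LeafSupport.mkN (LeafSupport.cm l)) κtop) (canon₁₄ (LeafSupport.mkN (LeafSupport.cm l))) (cm₄₅G l) (canon₅₂ (LeafSupport.mkN (LeafSupport.cm l))) (cm₅₆F l) (cm₁₃₁F l) (cm₁₅₃G l) ∧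
      (¬ (canon₅₂ (LeafSupport.mkN (LeafSupport.cm l))).TadicCorank3 ∧ ¬ (cm₁₃₁F l).TamCount ∧ ¬ (cm₁₃₁F l).TamTASpackets ∧ ¬ (cm₅₆F l).ChenZouThetaPackets) :=
  have nb := not_B_cm l
  ⟨(LeafSupport.countermodel l).2.2.1, canon_implications₁₅₆ (LeafSupport.mkN (LeafSupport.cm l)) μtop κtop (canon (LeafSupport.mkN (LeafSupport.cm l)) μtop κtop) True, ⟨nb, fun h => nb h.1.1, fun h => nb h.1, fun h => nb h.1.1⟩⟩

/-- MOK SIDE (Tam's packets and A11): book at the top, Mok's countermodel of ANY Mok leaf (KMSW reading `κnoMok`; g granted): the edges hold, B108 and Tam's count HOLD (book side: B75's two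
family instances by `moeglinOrthSymp_of_inputs` from the book's top inputs, E43 by `moeglinUnitaryDS_of_published`), Tam's packets and A11 FAIL (« [Mok15] »; A6's unitary half).
[cite: Tam2025DepthZero, Thm 1.1; ChenZou2021ThetaPackets, Thm 2.8, §1 (p0003:L19) (bookkeeping proved here)] -/
theorem c156_mok_cm (l : Mok2015.LeafSupport.Leaf) :
    ¬ (Mok2015.LeafSupport.mkN (Mok2015.LeafSupport.cm l)).leaf l ∧
      Implications156 νtop (Mok2015.LeafSupport.mkN (Mok2015.LeafSupport.cm l)) κnoMok (canon νtop (Mok2015.LeafSupport.mkN (Mok2015.LeafSupport.cm l)) κnoMok) (canon₂ νtop (Mok2015.LeafSupport.mkN (Mok2015.LeafSupport.cm l)) κnoMok) (canon₁₃ νtop κnoMok) (canon₁₄ νtop) (canon₄₅S νtop κnoMok True) (canon₅₂ νtop)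
        (canon₅₆F νtop (Mok2015.LeafSupport.mkN (Mok2015.LeafSupport.cm l)) κnoMok) (canon₁₃₁F νtop (Mok2015.LeafSupport.mkN (Mok2015.LeafSupport.cm l)) κnoMok) (canon₁₅₃ νtop κnoMok (canon νtop (Mok2015.LeafSupport.mkN (Mok2015.LeafSupport.cm l)) κnoMok) True) ∧
      ((canon₅₂ νtop).TadicCorank3 ∧ (canon₁₃₁F νtop (Mok2015.LeafSupport.mkN (Mok2015.LeafSupport.cm l)) κnoMok).TamCount) ∧
      (¬ (canon₁₃₁F νtop (Mok2015.LeafSupport.mkN (Mok2015.LeafSupport.cm l)) κnoMok).TamTASpackets ∧ ¬ (canon₅₆F νtop (Mok2015.LeafSupport.mkN (Mok2015.LeafSupport.cm l)) κnoMok).ChenZouThetaPackets) :=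
  have nm := not_M_cm l
  have Y := canon_implications₁₅₆ νtop (Mok2015.LeafSupport.mkN (Mok2015.LeafSupport.cm l)) κnoMok (canon νtop (Mok2015.LeafSupport.mkN (Mok2015.LeafSupport.cm l)) κnoMok) True
  have V := canon_implications₄₅S νtop (Mok2015.LeafSupport.mkN (Mok2015.LeafSupport.cm l)) κnoMok True
  have h := (moeglinOrthSymp_of_inputs (canon_implications₁₅₃ νtop κnoMok (canon νtop (Mok2015.LeafSupport.mkN (Mok2015.LeafSupport.cm l)) κnoMok) True) V (canon_implications νtop (Mok2015.LeafSupport.mkN (Mok2015.LeafSupport.cm l)) κnoMok) (canon_implications₁₃ νtop (Mok2015.LeafSupport.mkN (Mok2015.LeafSupport.cm l)) κnoMok)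
    bookInputs_top).2
  ⟨(Mok2015.LeafSupport.countermodel l).2.2.1, Y, ⟨bookInputs_top.everything, Y.tamCountF h.1 h.2.1 (moeglinUnitaryDS_of_published V bookInputs_top.published)⟩,
    ⟨fun t => nm t.2.1, fun t => nm t.1.2⟩⟩

/-- THE HUNDRED-AND-FIFTY-SIXTH TRANCHE REGRADED, in one statement: (i) at the top with the general-spin instance DENIED B108, Tam's count and packets, A11 hold while B75's node fails; (ii) in
the book countermodel of any of the 24 leaves all four fail; (iii) in Mok's countermodel of any Mok leaf B108 and Tam's count hold, Tam's packets and A11 fail.  Supports, exact, through the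
family edges: support(`TadicCorank3`) = the 24 book leaves; support(`TamCount`) = the 24 leaves (E43's five and [MR18]'s orthogonal leaves among them); support(`TamTASpackets`) = the 24
leaves ∧ Mok's 29 leaves ∧ KMSW's proved scope (section 131, unchanged); support(`ChenZouThetaPackets`) = the 24 leaves ∧ Mok's leaves (section 56, unchanged) — and, for none of them,
B75's node or its general-spin instance. [cite: Tadic2023Corank3, §6; Tam2025DepthZero, (2.19), Thm 1.1; ChenZou2021ThetaPackets, Thm 2.8; Moeglin2011Mult1, Thm 2.5.1; MoeglinRenard2018, §3.1 (bookkeeping proved here)] [claim: KalethaMinguezShinWhite2014, under-review] -/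
theorem c156_regraded :
    (((canon₅₂ νtop).TadicCorank3 ∧ ((canon₁₃₁F νtop μtop κtop).TamCount ∧ (canon₁₃₁F νtop μtop κtop).TamTASpackets) ∧ (canon₅₆F νtop μtop κtop).ChenZouThetaPackets) ∧
        ¬ (canon₄₅S νtop κtop False).MoeglinDSHyp) ∧
      (∀ l : LeafSupport.Leaf, ¬ (LeafSupport.mkN (LeafSupport.cm l)).leaf l ∧ ¬ (canon₅₂ (LeafSupport.mkN (LeafSupport.cm l))).TadicCorank3 ∧ ¬ (cm₁₃₁F l).TamCount ∧ ¬ (cm₁₃₁F l).TamTASpackets ∧ ¬ (cm₅₆F l).ChenZouThetaPackets) ∧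
      (∀ l : Mok2015.LeafSupport.Leaf, ¬ (Mok2015.LeafSupport.mkN (Mok2015.LeafSupport.cm l)).leaf l ∧ ((canon₅₂ νtop).TadicCorank3 ∧ (canon₁₃₁F νtop (Mok2015.LeafSupport.mkN (Mok2015.LeafSupport.cm l)) κnoMok).TamCount) ∧
        ¬ (canon₁₃₁F νtop (Mok2015.LeafSupport.mkN (Mok2015.LeafSupport.cm l)) κnoMok).TamTASpackets ∧ ¬ (canon₅₆F νtop (Mok2015.LeafSupport.mkN (Mok2015.LeafSupport.cm l)) κnoMok).ChenZouThetaPackets) :=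
  have d := c156_gspin_denied
  ⟨⟨d.2.1, d.2.2.1⟩,
    fun l =>
      have h := c156_book_cm l
      ⟨h.1, h.2.2⟩,
    fun l =>
      have h := c156_mok_cm l
      ⟨h.1, h.2.2.1, h.2.2.2⟩⟩

/-! ## 159. Hundred-and-fifty-seventh tranche (v11 of this file; unit `pub-arthur-down-g67`): supports of row B16 (C. Cunningham – A. Fiori – A. Moussaoui – J. Mracek – B. Xu, Mem. AMS 276
(2022)) with its Mœglin binder RE-ISSUED BY FAMILY (tranche 157, `Downstream44.lean` v3).  Section 135's (`DownstreamSupport16.lean`) `canon₁₃₅W ν c₈ c₄₅` read B16's pure packets :=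
the book ∧ the Chapter-9 leaf ∧ `c₄₅.MoeglinMult1`; the FAMILY reading `canon₁₃₅FW ν κ c₈` puts (B75 quasi-split ∧ B75 non-quasi-split orthogonal) = (the book ∧ (the book ∧ [MR18]'s
orthogonal value)) in B75's slot, general-spin-free, for ANY assignment c₈ of tranche 8 (Chapter-9 leaf granted: `canon₈`; denied: `canon₈no`).  The landed edges of tranche 135 hold in
it over section 155's `canon₄₅S ν κ g` for every g and every c₈ (`canon_implications₁₃₅FW`), the family edge too (`canon_implications₁₅₇W`).  ROUTE: at the top WITH THE GENERAL-SPIN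
INSTANCE DENIED (leaf granted) B16's node, pure packets and Part-2 verifications are delivered by the tranche's `cfmmxF_of_inputs` while B75's node fails (`c157_gspin_denied`); in each
of the 24 book countermodels all three fail (`c157_book_cm`); with the Chapter-9 leaf denied they fail for every ν, μ, κ, g (`c157_ch9_denied`, section 135's verdict re-read); Mok's
memoir and KMSW play no part — in Mok's countermodels (KMSW read `κnoMok`) all three hold (`c157_mok_cm`).  Section 135's « ∧ B75's node » (separating reading `canon₁₃₅noR`) no longer
describes B16's support. -/

section Canon157

variable (ν : Nodes) (μ : Mok2015.Nodes) (κ : KMSW2014.Nodes) (c : Consumers) (g : Prop)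

/-- The FAMILY reading of row B16 over an arbitrary tranche-8 assignment `c₈`: node := the book ∧ the Chapter-9 leaf (as in section 135); pure packets := the book ∧ the leaf ∧ (B75
quasi-split ∧ B75 non-quasi-split orthogonal); Part-2 verifications := the book ∧ the packets' value ∧ the node's value. [cite: CunninghamEtAl2022ABV, §§3.9–3.11, 9; Moeglin2011Mult1, Thm 2.5.1; MoeglinRenard2018, §3.1 (canonical model; bookkeeping)] -/
abbrev canon₁₃₅FW (c₈ : Consumers8) : Consumers135 where
  CFMMXvoganLLC := (∀ N, ν.Everything N) ∧ c₈.InnerTwists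
  CFMMXpurePackets := (∀ N, ν.Everything N) ∧ c₈.InnerTwists ∧ ((∀ N, ν.Everything N) ∧ ((∀ N, ν.Everything N) ∧ (canon₁₃ ν κ).MRpadicOrth))
  CFMMXexamples := (∀ N, ν.Everything N) ∧ ((∀ N, ν.Everything N) ∧ c₈.InnerTwists ∧ ((∀ N, ν.Everything N) ∧ ((∀ N, ν.Everything N) ∧ (canon₁₃ ν κ).MRpadicOrth))) ∧ ((∀ N, ν.Everything N) ∧ c₈.InnerTwists)

/-- The LANDED edges of tranche 135 hold in the family reading over section 155's `canon₄₅S ν κ g`, for arbitrary ν, κ, g, c₈ (B75 as printed there := quasi-split ∧ orthogonal ∧ g,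
which implies the family value). [cite: CunninghamEtAl2022ABV, §3.11 (bookkeeping proved here)] -/
theorem canon_implications₁₃₅FW (c₈ : Consumers8) : Implications135 ν c₈ (canon₄₅S ν κ g) (canon₁₃₅FW ν κ c₈) where
  node := fun b n => ⟨b, n⟩
  pure := fun b n m => ⟨b, n, ⟨m.1, ⟨m.1, m.2.1⟩⟩⟩
  ex := fun b p v => ⟨b, p, v⟩

/-- The family edge of tranche 157 holds in the family reading over `canon₄₅S ν κ g` / `canon₁₅₃ ν κ c g`, for arbitrary ν, κ, c, g, c₈. [cite: CunninghamEtAl2022ABV, §3.11 (bookkeeping proved here)] -/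
theorem canon_implications₁₅₇W (c₈ : Consumers8) : Implications157 ν c₈ (canon₄₅S ν κ g) (canon₁₃₅FW ν κ c₈) (canon₁₅₃ ν κ c g) where
  pureF := fun b n qs o => ⟨b, n, ⟨qs, o⟩⟩

end Canon157

/-- Book-countermodel instance of the family reading (Mok, KMSW at the top; Chapter-9 leaf granted). [cite: CunninghamEtAl2022ABV, §3.11 (separating models; bookkeeping)] -/
abbrev cm₁₃₅F (l : LeafSupport.Leaf) : Consumers135 := canon₁₃₅FW (LeafSupport.mkN (LeafSupport.cm l)) κtop (canon₈ (LeafSupport.mkN (LeafSupport.cm l)) μtop κtop)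

/-- AT THE TOP WITH THE GENERAL-SPIN INSTANCE DENIED (g := `False`; Chapter-9 leaf granted): B16's node, pure packets and Part-2 verifications HOLD — delivered by the tranche's
`cfmmxF_of_inputs` from the canonical bundles of tranches 1, 13, 45 (instantiated), 135 (family reading), 153, 157 and the top inputs of the book's DAG —, while B75's node and B75 as
printed FAIL in the same reading: the general-spin residue is NOT in B16's support. [cite: CunninghamEtAl2022ABV, §3.9 (arXiv v5 PDF p0023:L14-15), §3.10 (p0024:L47-49), §9 (separating model; bookkeeping proved here)] -/
theorem c157_gspin_denied :
    (Implications157 νtop (canon₈ νtop μtop κtop) (canon₄₅S νtop κtop False) (canon₁₃₅FW νtop κtop (canon₈ νtop μtop κtop)) (canon₁₅₃ νtop κtop (canon νtop μtop κtop) False) ∧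
        Implications135 νtop (canon₈ νtop μtop κtop) (canon₄₅S νtop κtop False) (canon₁₃₅FW νtop κtop (canon₈ νtop μtop κtop))) ∧
      ((canon₁₃₅FW νtop κtop (canon₈ νtop μtop κtop)).CFMMXvoganLLC ∧ (canon₁₃₅FW νtop κtop (canon₈ νtop μtop κtop)).CFMMXpurePackets ∧
        (canon₁₃₅FW νtop κtop (canon₈ νtop μtop κtop)).CFMMXexamples) ∧
      (¬ (canon₄₅S νtop κtop False).MoeglinDSHyp ∧ ¬ (canon₄₅S νtop κtop False).MoeglinMult1) :=
  have Y := canon_implications₁₅₇W νtop κtop (canon νtop μtop κtop) False (canon₈ νtop μtop κtop)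
  have Z := canon_implications₁₃₅FW νtop κtop False (canon₈ νtop μtop κtop)
  ⟨⟨Y, Z⟩,
    cfmmxF_of_inputs Y Z (canon_implications₄₅S νtop μtop κtop False) (canon_implications₁₅₃ νtop κtop (canon νtop μtop κtop) False) (canon_implications νtop μtop κtop)
      (canon_implications₁₃ νtop μtop κtop) bookInputs_top True.intro,
    ⟨fun x => x.2.2, fun x => x.2.2⟩⟩

/-- BOOK SIDE: in the book countermodel of ANY of the 24 leaves `l` (Mok, KMSW at the top; g granted; Chapter-9 leaf granted) both bundles hold and B16's node, pure packets, Part-2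
verifications all FAIL. [cite: CunninghamEtAl2022ABV, §1.2 (p0009:L46-48) (bookkeeping proved here)] -/
theorem c157_book_cm (l : LeafSupport.Leaf) :
    ¬ (LeafSupport.mkN (LeafSupport.cm l)).leaf l ∧ (Implications157 (LeafSupport.mkN (LeafSupport.cm l)) (canon₈ (LeafSupport.mkN (LeafSupport.cm l)) μtop κtop) (cm₄₅G l) (cm₁₃₅F l) (cm₁₅₃G l) ∧ Implications135 (LeafSupport.mkN (LeafSupport.cm l)) (canon₈ (LeafSupport.mkN (LeafSupport.cm l)) μtop κtop) (cm₄₅G l) (cm₁₃₅F l)) ∧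
      (¬ (cm₁₃₅F l).CFMMXvoganLLC ∧ ¬ (cm₁₃₅F l).CFMMXpurePackets ∧ ¬ (cm₁₃₅F l).CFMMXexamples) :=
  have nb := not_B_cm l
  ⟨(LeafSupport.countermodel l).2.2.1,
    ⟨canon_implications₁₅₇W (LeafSupport.mkN (LeafSupport.cm l)) κtop (canon (LeafSupport.mkN (LeafSupport.cm l)) μtop κtop) True (canon₈ (LeafSupport.mkN (LeafSupport.cm l)) μtop κtop), canon_implications₁₃₅FW (LeafSupport.mkN (LeafSupport.cm l)) κtop True (canon₈ (LeafSupport.mkN (LeafSupport.cm l)) μtop κtop)⟩,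
    ⟨fun h => nb h.1, fun h => nb h.1, fun h => nb h.1⟩⟩

/-- CHAPTER-9 LEAF DENIED (`canon₈no`), for EVERY ν, μ, κ, g: both bundles hold and B16's node, pure packets, Part-2 verifications FAIL — section 135's verdict on [A28] re-read through
the family edge. [cite: CunninghamEtAl2022ABV, §3.10 (p0024:L40-49), §9 (separating model; bookkeeping proved here)] -/
theorem c157_ch9_denied (ν : Nodes) (μ : Mok2015.Nodes) (κ : KMSW2014.Nodes) (g : Prop) :
    (Implications157 ν (canon₈no ν μ) (canon₄₅S ν κ g) (canon₁₃₅FW ν κ (canon₈no ν μ)) (canon₁₅₃ ν κ (canon ν μ κ) g) ∧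
        Implications135 ν (canon₈no ν μ) (canon₄₅S ν κ g) (canon₁₃₅FW ν κ (canon₈no ν μ))) ∧
      (¬ (canon₁₃₅FW ν κ (canon₈no ν μ)).CFMMXvoganLLC ∧ ¬ (canon₁₃₅FW ν κ (canon₈no ν μ)).CFMMXpurePackets ∧ ¬ (canon₁₃₅FW ν κ (canon₈no ν μ)).CFMMXexamples) :=
  ⟨⟨canon_implications₁₅₇W ν κ (canon ν μ κ) g (canon₈no ν μ), canon_implications₁₃₅FW ν κ g (canon₈no ν μ)⟩, ⟨fun h => h.2, fun h => h.2.1, fun h => h.2.2.2⟩⟩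

/-- MOK SIDE: book at the top, Mok's countermodel of ANY Mok leaf (KMSW read `κnoMok`; g and the Chapter-9 leaf granted): B16's three statements HOLD — no Mok / KMSW premise in the line,
B75's family instances from the book's top inputs. [cite: CunninghamEtAl2022ABV, §3.9 (p0023:L14-15) (bookkeeping proved here)] -/
theorem c157_mok_cm (l : Mok2015.LeafSupport.Leaf) :
    ¬ (Mok2015.LeafSupport.mkN (Mok2015.LeafSupport.cm l)).leaf l ∧ (canon₁₃₅FW νtop κnoMok (canon₈ νtop (Mok2015.LeafSupport.mkN (Mok2015.LeafSupport.cm l)) κnoMok)).CFMMXvoganLLC ∧ (canon₁₃₅FW νtop κnoMok (canon₈ νtop (Mok2015.LeafSupport.mkN (Mok2015.LeafSupport.cm l)) κnoMok)).CFMMXpurePackets ∧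
      (canon₁₃₅FW νtop κnoMok (canon₈ νtop (Mok2015.LeafSupport.mkN (Mok2015.LeafSupport.cm l)) κnoMok)).CFMMXexamples :=
  have Y := canon_implications₁₅₇W νtop κnoMok (canon νtop (Mok2015.LeafSupport.mkN (Mok2015.LeafSupport.cm l)) κnoMok) True (canon₈ νtop (Mok2015.LeafSupport.mkN (Mok2015.LeafSupport.cm l)) κnoMok)
  have Z := canon_implications₁₃₅FW νtop κnoMok True (canon₈ νtop (Mok2015.LeafSupport.mkN (Mok2015.LeafSupport.cm l)) κnoMok)
  ⟨(Mok2015.LeafSupport.countermodel l).2.2.1,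
    cfmmxF_of_inputs Y Z (canon_implications₄₅S νtop (Mok2015.LeafSupport.mkN (Mok2015.LeafSupport.cm l)) κnoMok True) (canon_implications₁₅₃ νtop κnoMok (canon νtop (Mok2015.LeafSupport.mkN (Mok2015.LeafSupport.cm l)) κnoMok) True) (canon_implications νtop (Mok2015.LeafSupport.mkN (Mok2015.LeafSupport.cm l)) κnoMok)
      (canon_implications₁₃ νtop (Mok2015.LeafSupport.mkN (Mok2015.LeafSupport.cm l)) κnoMok) bookInputs_top True.intro⟩

/-- THE HUNDRED-AND-FIFTY-SEVENTH TRANCHE REGRADED, in one statement: (i) at the top with the general-spin instance DENIED B16's three statements hold while B75's node fails; (ii) in the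
book countermodel of any of the 24 leaves all three fail; (iii) with the Chapter-9 leaf denied the pure packets and the Part-2 verifications fail for every assignment; (iv) in Mok's
countermodel of any Mok leaf the verifications hold.  Supports, exact, through the family edge: support(`CFMMXpurePackets`) = support(`CFMMXexamples`) = the 24 book leaves ∧ the leaf
`InnerTwists` ([A28]) — and NOT B75's node nor its general-spin instance. [cite: CunninghamEtAl2022ABV, §§3.9–3.11, 9; Moeglin2011Mult1, Thm 2.5.1; MoeglinRenard2018, §3.1 (bookkeeping proved here)] -/
theorem c157_regraded :
    (((canon₁₃₅FW νtop κtop (canon₈ νtop μtop κtop)).CFMMXvoganLLC ∧ (canon₁₃₅FW νtop κtop (canon₈ νtop μtop κtop)).CFMMXpurePackets ∧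
          (canon₁₃₅FW νtop κtop (canon₈ νtop μtop κtop)).CFMMXexamples) ∧ ¬ (canon₄₅S νtop κtop False).MoeglinDSHyp) ∧
      (∀ l : LeafSupport.Leaf, ¬ (LeafSupport.mkN (LeafSupport.cm l)).leaf l ∧ ¬ (cm₁₃₅F l).CFMMXvoganLLC ∧ ¬ (cm₁₃₅F l).CFMMXpurePackets ∧ ¬ (cm₁₃₅F l).CFMMXexamples) ∧
      (∀ (ν : Nodes) (μ : Mok2015.Nodes) (κ : KMSW2014.Nodes), ¬ (canon₁₃₅FW ν κ (canon₈no ν μ)).CFMMXpurePackets ∧ ¬ (canon₁₃₅FW ν κ (canon₈no ν μ)).CFMMXexamples) ∧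
      (∀ l : Mok2015.LeafSupport.Leaf, ¬ (Mok2015.LeafSupport.mkN (Mok2015.LeafSupport.cm l)).leaf l ∧ (canon₁₃₅FW νtop κnoMok (canon₈ νtop (Mok2015.LeafSupport.mkN (Mok2015.LeafSupport.cm l)) κnoMok)).CFMMXexamples) :=
  have d := c157_gspin_denied
  ⟨⟨d.2.1, d.2.2.1⟩,
    fun l =>
      have h := c157_book_cm l
      ⟨h.1, h.2.2⟩,
    fun ν μ κ =>
      have h := c157_ch9_denied ν μ κ True
      ⟨h.2.2.1, h.2.2.2⟩,
    fun l =>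
      have h := c157_mok_cm l
      ⟨h.1, h.2.2.2⟩⟩

end Support

end Downstream

end Literature.NumberTheory.Automorphic.Arthur2013
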